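import Literature.NumberTheory.LFunctions.AriasDeReynaKeiperLiCoefficientsProofs
import Literature.NumberTheory.LFunctions.LogIntegralLaplaceTransform
import Literature.NumberTheory.LFunctions.LittlewoodOscillationInputsPiProofs
import Literature.NumberTheory.LFunctions.RHConditionalFactsVonKochProofs
import Literature.NumberTheory.LFunctions.PrimeNumberTheoremErrorTermProofs
import Literature.Analysis.SpecialFunctions.LaguerrePolynomial
import Literature.Analysis.SpecialFunctions.LaguerreOrthogonality
import Literature.Analysis.SpecialFunctions.LaguerreExpansionUniqueness
import Mathlib.Analysis.SpecialFunctions.Gaussian.GaussianIntegral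
import Mathlib.MeasureTheory.Function.L2Space
import Mathlib.Analysis.InnerProductSpace.Subspace
import Mathlib.NumberTheory.LSeries.Injectivity
import HarnessLib

/-!
# Arias de Reyna 2011, §5: the Keiper–Li coefficients and the primes (Prop 5.1, Thm 5.1, (22)–(23), Thm 5.2)

LINE 1 — LABEL: RH-FREE corpus typing AND proving (cell `rh-crit/dbl`, NODES row AdR11 §5, lineage t13 =
S18/S20 Keiper–Li asymptotic criteria).  Every declaration in this file is an RH-FREE definition or a PROVED
identity; no named fact is introduced.  bears_on: LADDER-RH L-C/L-P (COLUMN 4 LI).  WHAT THIS IS NOT: an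
integral formula for `A_n` in terms of `Π(x) − li(x)` fixes what the Keiper–Li coefficients ARE in prime
terms; it proves nothing toward RH and is not worded as progress toward it; nothing here bears on the truth
of RH.

Source: J. Arias de Reyna, *Asymptotics of Keiper–Li coefficients*, Funct. Approx. Comment. Math. 45 (2011)
7–21 [AriasDeReyna2011KeiperLi], §5 «The connection of the Keiper–Li coefficients with primes», pp. 15–18
(held: `paper:reyna2011-asymptotics-keiper-li-coefficients`).  Notation as in
`AriasDeReynaKeiperLiCoefficients.lean`: `A_n = ariasA n` (eq. (4)), `λ_m = keiperLambdaK m` (Keiper's),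
`L_n` the Laguerre polynomial `Literature.Analysis.SpecialFunctions.laguerre 0 n`
(`L_n(t) = Σ_j C(n,j)(−t)ʲ/j!`, `eval_laguerre_zero_eq`), `li = Literature.NumberTheory.LFunctions.logIntegral`
(the principal-value logarithmic integral, `li(eᵘ) = Ei(u)` — this is the paper's `Li`: (21) and
`A_0 = 0` (22) force the principal-value normalisation), `Π(x) = Σ_{n≤x} Λ(n)/log n` (`primePowerPi`, (18)).

## What is typed (source item → Lean → status)

* Prop 5.1 p.15 → `AriasDeReyna2011_prop51` (PROVED; special case `f` real-valued —
  `-- TODO(general form): complex-valued f`; the hypothesis «`F(s) = s∫₁^∞ f x^{−s−1}`, `Re s > 1`, extends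
  analytically to a neighbourhood of `1`» is typed as: `F` analytic at `1` and equal to `s·∫` on
  `{Re s > 1}` near `1`; conclusion = the `n`-th Taylor coefficient of `F(1/(1−z))` at `0` is
  `∫₀^∞ f(eᵗ) L_n(t) e^{−t} dt`, plus the expansion itself `AriasDeReyna2011_prop51_hasSum`).  The printed
  proof is followed: `F⁽ᵏ⁾(s)` under the integral sign for `Re s > 1` (tree: Landau-lemma machinery
  `Landau.iteratedDeriv_mellinIoi`), dominated convergence `s → 1⁺`, then the re-expansion in
  `z = 1 − 1/s` (tree: Li's change of variables `iteratedDeriv_pow_mul_eq_iteratedDeriv_comp_liMap`, Leibniz).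
* eq. (21) p.17 → `AriasDeReyna2011_eq21` (PROVED: `log{(σ−1)ζ(σ)} = σ∫₁^∞{Π(x) − li(x)}x^{−σ−1}dx` for real
  `σ > 1`; `Π`-half = tree `PiOmega.mellinIoi_primePowerPi`, `li`-half = `LogIntegralLaplace.mellinIoi_logIntegral`,
  the identification `Σ Λ(n)/(log n) n^{−σ} + log(σ−1) = log ζ₁(σ)` by `d/dσ = 0` and `σ → ∞`) and its
  continuation `AriasDeReyna2011_eq21_nhds` to complex `s` near `1` with `Re s > 1` (identity theorem).
* Thm 5.1 (20) p.17 → `AriasDeReyna2011_thm51` (PROVED: `A_n = ∫₀^∞ {Π(eᵗ) − li(eᵗ)} L_n(t) e^{−t} dt`; the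
  hypothesis of Prop 5.1 = the prime number theorem with remainder `O(x/logᴬx)` for every `A`, tree
  `ChebyshevThetaDeLaValleePoussin_holds.logPow` transferred to `π − li` by MV (13.5)
  `VonKochTransfer.primeCounting_sub_logIntegral_eq`, and `0 ≤ Π − π ≤ 2√x log x/log 2`).
* (22), (23) p.17 → `AriasDeReyna2011_eq22`, `AriasDeReyna2011_eq23` (PROVED).
* Thm 5.2 (24) p.18 → `AriasDeReyna2011_thm52` (PROVED, `m ≥ 2`, with `I_m = ariasI m` as in
  `AriasDeReynaKeiperLiCoefficients.lean`).
* Cor 5.1 p.17 (RH ⟺ `(Π(x) − li(x))/x ∈ L²(1,∞)`, «independent proof of the main result in [1]» =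
  Arias de Reyna 2008) → `AriasDeReyna2011_cor51_mpr` (PROVED, RH-FREE: the ⟸ half — square-integrability
  ⟹ `(A_n) ∈ ℓ²` by BESSEL's inequality for the Laguerre functions `ℓ_n = L_n e^{−t/2}` (tree
  `LaguerreOrthogonality.sum_sq_integral_mul_laguerreFn_le`, only orthonormality is used) ⟹ RH by Thm 4.3 ⟸
  `AriasDeReyna2011_thm43_mpr`), and ONE RH-CONSEQUENCE NAMED FACT `AriasDeReyna2011_cor51_mp` (the ⟹ half,
  binder explicit), NOW DISCHARGED: `AriasDeReyna2011_cor51_mp_holds` (PROVED from RH ⟹ `(A_n) ∈ ℓ²`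
  (`AriasDeReyna2011_thm43_holds`) by Riesz–Fischer in `L²(0,∞)` for the Laguerre functions plus the
  uniqueness theorem for Laguerre expansions of exponentially tempered functions
  (`LaguerreExpansionUniqueness.lean`, Szegő Thm 5.7.1; temperedness of `g` under RH from von Koch), the
  unprinted step of the paper's «According to (20), this is equivalent to …»), glued in
  `AriasDeReyna2011_cor51_of_mp` and `AriasDeReyna2011_cor51` (the printed equivalence, PROVED).
  «`∈ L²(1,∞)`» is typed as square-integrability `IntegrableOn (fun x ↦ ((Π x − li x)/x)²) (Ioi 1)` of the
  (measurable) function.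
* Displays (18)–(19) are notation (`Π`, `ψ`, `M`); the `B_n`, `C_n` integrals p.17 are remarks, not typed.

## References

* [AriasDeReyna2011KeiperLi] J. Arias de Reyna, Funct. Approx. Comment. Math. 45 (2011) 7–21,
  doi:10.7169/facm/1317045228, §5.
* [MontgomeryVaughan2007] H. L. Montgomery, R. C. Vaughan, *Multiplicative Number Theory I*, CUP 2007,
  Thm 1.3 (Mellin transform of `Π`), Thm 6.9, (13.5).
* [Szego1975] G. Szegő, *Orthogonal Polynomials*, (5.1.6) (Laguerre polynomials).
-/

noncomputable section

open Filter Topology Set MeasureTheory Asymptotics Finset Polynomial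
open scoped Nat Chebyshev

namespace Literature.NumberTheory.LFunctions

open Literature.Analysis.SpecialFunctions (laguerre laguerreCoeff eval_laguerre laguerre_zero laguerre_one)
open Landau (mellinIoi mellinIoiLog)

/-! ## Laguerre polynomials at `α = 0`: `L_n(t) = Σ_j C(n,j)(−t)ʲ/j!` -/

namespace AriasDeReyna2011Primes

/-- The coefficients of the classical Laguerre polynomial: `[tʲ]L_n = (−1)ʲ C(n,j)/j!` (`j ≤ n`).
[cite: Szego1975, (5.1.6)] -/
theorem laguerreCoeff_zero_eq {n j : ℕ} (hj : j ≤ n) :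
    laguerreCoeff 0 n j = (-1) ^ j * (n.choose j : ℝ) / (j ! : ℝ) := by
  rw [laguerreCoeff]
  have hP : (ascPochhammer ℝ (n - j)).eval ((0 : ℝ) + j + 1) = ((n)! : ℝ) / (j ! : ℝ) := by
    have h1 : ((0 : ℝ) + j + 1) = ((j + 1 : ℕ) : ℝ) := by push_cast; ring
    rw [h1, ← ascPochhammer_eval_cast, ascPochhammer_nat_eq_ascFactorial]
    have h2 : (j ! : ℝ) * ((j + 1).ascFactorial (n - j) : ℝ) = (n ! : ℝ) := by
      have := Nat.factorial_mul_ascFactorial j (n - j)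
      rw [Nat.add_sub_cancel' hj] at this
      exact_mod_cast this
    have hj0 : (j ! : ℝ) ≠ 0 := by positivity
    field_simp
    linear_combination h2
  rw [hP]
  have hc : (n.choose j : ℝ) = (n ! : ℝ) / ((j ! : ℝ) * ((n - j)! : ℝ)) := by
    have := Nat.choose_mul_factorial_mul_factorial hj
    have h1 : (j ! : ℝ) ≠ 0 := by positivity
    have h2 : ((n - j)! : ℝ) ≠ 0 := by positivity
    field_simp
    exact_mod_cast this
  rw [hc]
  have h1 : (j ! : ℝ) ≠ 0 := by positivity
  have h2 : ((n - j)! : ℝ) ≠ 0 := by positivity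
  field_simp

/-- `L_n(t) = Σ_{j ≤ n} (−1)ʲ C(n,j) tʲ/j!`. [cite: Szego1975, (5.1.6)] -/
theorem eval_laguerre_zero_eq (n : ℕ) (t : ℝ) :
    (laguerre 0 n).eval t = ∑ j ∈ range (n + 1), (-1) ^ j * (n.choose j : ℝ) / (j ! : ℝ) * t ^ j := by
  rw [eval_laguerre]
  refine Finset.sum_congr rfl fun j hj ↦ ?_
  rw [laguerreCoeff_zero_eq (Nat.lt_succ_iff.mp (Finset.mem_range.mp hj))]

/-! ## Proposition 5.1 -/

variable {f : ℝ → ℝ}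

/-- The hypothesis `f(x) x^{−2} (log x)ⁿ ∈ L¹(1,∞)` at `n = 0`, in the currency of the tree's Landau-lemma
transform (`σ₁ = 1`). [cite: AriasDeReyna2011KeiperLi, Proposition 5.1 p.15] -/
theorem integrableOn_base (hint : IntegrableOn (fun x ↦ f x * Real.log x ^ 0 * x ^ (-2 : ℝ)) (Ioi 1)) :
    IntegrableOn (fun x ↦ f x * x ^ (-((1 : ℝ) + 1))) (Ioi 1) := by
  refine hint.congr_fun (fun x _ ↦ ?_) measurableSet_Ioi
  norm_num

/-- The transform with `k` logarithms at a real point `σ`, as a real integral.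
[cite: AriasDeReyna2011KeiperLi, proof of Proposition 5.1 p.16] -/
theorem mellinIoiLog_ofReal' (f : ℝ → ℝ) (k : ℕ) (σ : ℝ) :
    mellinIoiLog f k (σ : ℂ) =
      (((-1 : ℝ) ^ k * ∫ x in Ioi (1 : ℝ), f x * Real.log x ^ k * x ^ (-(σ + 1)) : ℝ) : ℂ) :=
  Landau.mellinIoiLog_ofReal k σ

/-- **Dominated convergence `s → 1⁺`** (proof of Prop 5.1, «the dominated convergence theorem gives us
`F⁽ⁿ⁾(1) = …`»): `∫ f (log x)ᵏ x^{−(σ+1)} → ∫ f (log x)ᵏ x^{−2}` as `σ → 1⁺`.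
[cite: AriasDeReyna2011KeiperLi, proof of Proposition 5.1 p.16] -/
theorem tendsto_integral_logpow (hf : Measurable f) (k : ℕ)
    (hint : IntegrableOn (fun x ↦ f x * Real.log x ^ k * x ^ (-2 : ℝ)) (Ioi 1)) :
    Tendsto (fun σ : ℝ ↦ ∫ x in Ioi (1 : ℝ), f x * Real.log x ^ k * x ^ (-(σ + 1)))
      (𝓝[>] 1) (𝓝 (∫ x in Ioi (1 : ℝ), f x * Real.log x ^ k * x ^ (-2 : ℝ))) := by
  refine tendsto_integral_filter_of_dominated_convergence
    (bound := fun x ↦ |f x * Real.log x ^ k * x ^ (-2 : ℝ)|) ?_ ?_ hint.norm ?_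
  · refine Eventually.of_forall fun σ ↦ ?_
    exact ((hf.mul ((Real.measurable_log).pow_const k)).mul
      (measurable_id.pow_const _)).aestronglyMeasurable
  · refine eventually_nhdsWithin_of_forall fun σ (hσ : 1 < σ) ↦ ?_
    rw [ae_restrict_iff' measurableSet_Ioi]
    refine Eventually.of_forall fun x (hx : 1 < x) ↦ ?_
    have hx0 : 0 < x := by linarith
    have h1 : |x ^ (-(σ + 1))| = x ^ (-(σ + 1)) := abs_of_pos (Real.rpow_pos_of_pos hx0 _)
    have h2 : |x ^ (-2 : ℝ)| = x ^ (-2 : ℝ) := abs_of_pos (Real.rpow_pos_of_pos hx0 _)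
    rw [Real.norm_eq_abs, abs_mul, abs_mul, abs_mul, abs_mul, h1, h2]
    exact mul_le_mul_of_nonneg_left (Real.rpow_le_rpow_of_exponent_le hx.le (by linarith))
      (by positivity)
  · rw [ae_restrict_iff' measurableSet_Ioi]
    refine Eventually.of_forall fun x (hx : 1 < x) ↦ ?_
    have hx0 : 0 < x := by linarith
    have hc : ContinuousAt (fun σ : ℝ ↦ f x * Real.log x ^ k * x ^ (-(σ + 1))) 1 := by
      refine continuousAt_const.mul ?_
      exact (Real.continuousAt_const_rpow hx0.ne').comp (by fun_prop)
    have := hc.tendsto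
    rw [show (-((1 : ℝ) + 1)) = -2 by norm_num] at this
    exact this.mono_left nhdsWithin_le_nhds

/-- The same limit in the tree's complex currency: `mellinIoiLog f k σ → mellinIoiLog f k 1` as `σ → 1⁺`.
[cite: AriasDeReyna2011KeiperLi, proof of Proposition 5.1 p.16] -/
theorem tendsto_mellinIoiLog (hf : Measurable f) (k : ℕ)
    (hint : IntegrableOn (fun x ↦ f x * Real.log x ^ k * x ^ (-2 : ℝ)) (Ioi 1)) :
    Tendsto (fun σ : ℝ ↦ mellinIoiLog f k (σ : ℂ)) (𝓝[>] 1) (𝓝 (mellinIoiLog f k 1)) := by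
  have e1 : mellinIoiLog f k 1 =
      (((-1 : ℝ) ^ k * ∫ x in Ioi (1 : ℝ), f x * Real.log x ^ k * x ^ (-2 : ℝ) : ℝ) : ℂ) := by
    rw [show (1 : ℂ) = ((1 : ℝ) : ℂ) by simp, mellinIoiLog_ofReal']
    norm_num
  simp_rw [mellinIoiLog_ofReal', e1]
  exact (Complex.continuous_ofReal.tendsto _).comp
    ((tendsto_integral_logpow hf k hint).const_mul _)

/-- **Prop 5.1, derivatives at `s = 1`**: if `F` is analytic at `1` and `F(s) = s·∫₁^∞ f x^{−s−1}` on
`{Re s > 1}` near `1`, then for `M̃ = F(s)/s`: `M̃⁽ᵏ⁾(1) = ∫₁^∞ f(x)(−log x)ᵏ x^{−2} dx`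
(«`F⁽ⁿ⁾(1) = (−1)ⁿ⁻¹ n ∫ f (log x)ⁿ⁻¹ x⁻² + (−1)ⁿ ∫ f (log x)ⁿ x⁻²`», here for `F(s)/s`).
[cite: AriasDeReyna2011KeiperLi, proof of Proposition 5.1 p.16] -/
theorem iteratedDeriv_div_eq_mellinIoiLog (hf : Measurable f)
    (hint : ∀ n : ℕ, IntegrableOn (fun x ↦ f x * Real.log x ^ n * x ^ (-2 : ℝ)) (Ioi 1))
    {F : ℂ → ℂ} (hF1 : AnalyticAt ℂ F 1)
    (hF : ∃ r > 0, ∀ s : ℂ, 1 < s.re → dist s 1 < r → F s = s * mellinIoi f s) (k : ℕ) :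
    iteratedDeriv k (fun s ↦ F s / s) 1 = mellinIoiLog f k 1 := by
  obtain ⟨r, hr0, hr⟩ := hF
  set Mt : ℂ → ℂ := fun s ↦ F s / s with hMt
  have hMt1 : AnalyticAt ℂ Mt 1 := hF1.div analyticAt_id one_ne_zero
  -- (a) continuity of `Mt⁽ᵏ⁾` at `1`, restricted to the real half-line
  have hcont : ContinuousAt (iteratedDeriv k Mt) 1 := by
    obtain ⟨ρ, hρ0, hρ⟩ := hMt1.exists_ball_analyticOnNhd
    rw [iteratedDeriv_eq_iterate]
    exact ((AnalyticOnNhd.iterated_deriv hρ k) 1 (Metric.mem_ball_self hρ0)).continuousAt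
  have hlim1 : Tendsto (fun σ : ℝ ↦ iteratedDeriv k Mt (σ : ℂ)) (𝓝[>] 1) (𝓝 (iteratedDeriv k Mt 1)) := by
    have h := hcont.tendsto.comp (Complex.continuous_ofReal.tendsto (1 : ℝ))
    simp only [Function.comp_def] at h
    exact h.mono_left nhdsWithin_le_nhds
  -- (b) for real `σ ∈ (1, 1 + r)`: `Mt⁽ᵏ⁾(σ) = ∫ f (−log x)ᵏ x^{−(σ+1)}`
  have hbase := integrableOn_base (hint 0)
  have heq : ∀ᶠ σ : ℝ in 𝓝[>] 1, iteratedDeriv k Mt (σ : ℂ) = mellinIoiLog f k (σ : ℂ) := by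
    have hI : Ioo (1 : ℝ) (1 + r) ∈ 𝓝[>] (1 : ℝ) := Ioo_mem_nhdsGT (by linarith)
    filter_upwards [hI] with σ hσ
    have hσ1 : 1 < σ := hσ.1
    -- `Mt = mellinIoi f` on the open set `{Re s > 1} ∩ ball 1 r ∋ σ`
    have hU : IsOpen ({s : ℂ | 1 < s.re} ∩ Metric.ball (1 : ℂ) r) :=
      (Landau.isOpen_re_gt 1).inter Metric.isOpen_ball
    have hσU : (σ : ℂ) ∈ {s : ℂ | 1 < s.re} ∩ Metric.ball (1 : ℂ) r := by
      refine ⟨by simpa using hσ1, ?_⟩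
      rw [Metric.mem_ball, Complex.dist_eq, ← Complex.ofReal_one, ← Complex.ofReal_sub,
        Complex.norm_real, Real.norm_eq_abs, abs_of_pos (by linarith)]
      linarith [hσ.2]
    have hev : Mt =ᶠ[𝓝 (σ : ℂ)] mellinIoi f := by
      filter_upwards [hU.mem_nhds hσU] with s hs
      have hs0 : s ≠ 0 := by
        intro h; rw [h] at hs; simp at hs; linarith [hs.1]
      simp only [hMt]
      rw [hr s hs.1 (by simpa [Metric.mem_ball] using hs.2)]
      field_simp
    rw [hev.iteratedDeriv_eq, Landau.iteratedDeriv_mellinIoi hf hbase k (by simpa using hσ1)]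
  -- (c) both sides have limits along `σ → 1⁺`; the functions agree eventually
  have hlim2 : Tendsto (fun σ : ℝ ↦ mellinIoiLog f k (σ : ℂ)) (𝓝[>] 1) (𝓝 (mellinIoiLog f k 1)) :=
    tendsto_mellinIoiLog hf k (hint k)
  exact tendsto_nhds_unique_of_eventuallyEq hlim1 hlim2 heq

/-- `∫₁^∞ f(x) x⁻² L_n(log x) dx = Σ_j (−1)ʲC(n,j)/j! ∫₁^∞ f(x)(log x)ʲ x⁻² dx`
(last display of the proof of Prop 5.1). [cite: AriasDeReyna2011KeiperLi, proof of Proposition 5.1 p.16] -/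
theorem integral_mul_laguerre_log_eq_sum
    (hint : ∀ n : ℕ, IntegrableOn (fun x ↦ f x * Real.log x ^ n * x ^ (-2 : ℝ)) (Ioi 1)) (n : ℕ) :
    ∫ x in Ioi (1 : ℝ), f x * (laguerre 0 n).eval (Real.log x) * x ^ (-2 : ℝ) =
      ∑ j ∈ range (n + 1), (-1) ^ j * (n.choose j : ℝ) / (j ! : ℝ) *
        ∫ x in Ioi (1 : ℝ), f x * Real.log x ^ j * x ^ (-2 : ℝ) := by
  have e : (fun x ↦ f x * (laguerre 0 n).eval (Real.log x) * x ^ (-2 : ℝ)) = fun x ↦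
      ∑ j ∈ range (n + 1), (-1) ^ j * (n.choose j : ℝ) / (j ! : ℝ) *
        (f x * Real.log x ^ j * x ^ (-2 : ℝ)) := by
    funext x
    rw [eval_laguerre_zero_eq, Finset.mul_sum, Finset.sum_mul]
    refine Finset.sum_congr rfl fun j _ ↦ ?_
    ring
  rw [e, integral_finsetSum _ (fun j _ ↦ (hint j).const_mul _)]
  refine Finset.sum_congr rfl fun j _ ↦ ?_
  rw [integral_const_mul]

/-- Change of variables `x = eᵗ`: `∫₀^∞ f(eᵗ) L_n(t) e^{−t} dt = ∫₁^∞ f(x) L_n(log x) x⁻² dx`.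
[cite: AriasDeReyna2011KeiperLi, proof of Proposition 5.1 p.16] -/
theorem integral_exp_laguerre_eq (f : ℝ → ℝ) (n : ℕ) :
    ∫ t in Ioi (0 : ℝ), f (Real.exp t) * (laguerre 0 n).eval t * Real.exp (-t) =
      ∫ x in Ioi (1 : ℝ), f x * (laguerre 0 n).eval (Real.log x) * x ^ (-2 : ℝ) := by
  rw [LogIntegralLaplace.setIntegral_Ioi_one_eq_integral_exp]
  refine setIntegral_congr_fun measurableSet_Ioi fun t _ ↦ ?_
  rw [Real.log_exp, ← Real.exp_mul]
  have : Real.exp t * Real.exp (t * (-2 : ℝ)) = Real.exp (-t) := by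
    rw [← Real.exp_add]; ring_nf
  calc f (Real.exp t) * (laguerre 0 n).eval t * Real.exp (-t)
      = f (Real.exp t) * (laguerre 0 n).eval t * (Real.exp t * Real.exp (t * (-2 : ℝ))) := by rw [this]
    _ = Real.exp t * (f (Real.exp t) * (laguerre 0 n).eval t * Real.exp (t * (-2 : ℝ))) := by ring

/-- The combinatorial heart of Prop 5.1: for a function `M̃` smooth at `1` with
`M̃⁽ʲ⁾(1) = (−1)ʲ m_j`, `(1/n!) dⁿ/dsⁿ[sⁿ M̃(s)]_{s=1} = Σ_j C(n,j)(−1)ʲ m_j/j!` (Leibniz).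
[cite: AriasDeReyna2011KeiperLi, proof of Proposition 5.1 p.16] -/
theorem iteratedDeriv_pow_mul_div_factorial {Mt : ℂ → ℂ} {n : ℕ} (hMt : ContDiffAt ℂ n Mt 1)
    (m : ℕ → ℂ) (hm : ∀ j ≤ n, iteratedDeriv j Mt 1 = m j) :
    iteratedDeriv n (fun s ↦ s ^ n * Mt s) 1 / (n ! : ℂ) =
      ∑ j ∈ range (n + 1), (n.choose j : ℂ) / (j ! : ℂ) * m j := by
  have hpow : ContDiffAt ℂ n (fun s : ℂ ↦ s ^ n) 1 := (contDiffAt_id (𝕜 := ℂ) (x := (1 : ℂ))).pow n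
  have hL := iteratedDeriv_mul (x := (1 : ℂ)) hpow hMt
  have e : (fun s : ℂ ↦ s ^ n * Mt s) = (fun s : ℂ ↦ s ^ n) * Mt := rfl
  rw [e, hL]
  -- `(sⁿ)⁽ⁱ⁾(1) = n!/(n−i)!`
  have hpi : ∀ i ∈ range (n + 1), iteratedDeriv i (fun s : ℂ ↦ s ^ n) 1 = (n.descFactorial i : ℂ) := by
    intro i _
    rw [iteratedDeriv_pow]; simp
  rw [Finset.sum_div]
  -- reflect the sum `i ↦ n − i`
  rw [← Finset.sum_range_reflect]
  refine Finset.sum_congr rfl fun j hj ↦ ?_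
  have hjn : j ≤ n := Nat.lt_succ_iff.mp (Finset.mem_range.mp hj)
  have hj' : n + 1 - 1 - j = n - j := by omega
  rw [hj', hpi (n - j) (Finset.mem_range.mpr (by omega)), Nat.sub_sub_self hjn, hm j hjn,
    Nat.choose_symm hjn]
  -- `C(n,n-j)·n!/(j)!·m_j/n! = C(n,j) m_j/j!`: `n.descFactorial (n-j) = n!/j!`
  have hdf : (n.descFactorial (n - j) : ℂ) * (j ! : ℂ) = (n ! : ℂ) := by
    have := Nat.factorial_mul_descFactorial (Nat.sub_le n j)
    rw [Nat.sub_sub_self hjn] at this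
    exact_mod_cast (by rw [mul_comm] at this; exact this)
  have h1 : (n ! : ℂ) ≠ 0 := by exact_mod_cast (Nat.factorial_pos n).ne'
  have h2 : (j ! : ℂ) ≠ 0 := by exact_mod_cast (Nat.factorial_pos j).ne'
  field_simp
  linear_combination (n.choose j : ℂ) * m j * hdf

/-- RH-FREE, PROVED — **[AriasDeReyna2011KeiperLi] Proposition 5.1 p.15** (special case `f` real-valued).
«Let `f : (1,∞) → ℂ` be measurable with `f(x)x⁻²(log x)ⁿ ∈ L¹(1,∞)` for every `n ≥ 0`.  Suppose that
`F(s) = s∫₁^∞ f(x) x^{−s−1} dx`, `Re s > 1`, extends to an analytic function on a neighbourhood of `s = 1`.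
Then on a neighbourhood of `z = 0`: `F(1/(1−z)) = Σ_{n≥0} zⁿ ∫₀^∞ f(eᵗ) L_n(t) e^{−t} dt`.»  Typed as the
identity of the `n`-th Taylor coefficient of `F ∘ liMap` at `0` (`liMap z = 1/(1−z)`) with the Laguerre
integral; the expansion itself is `AriasDeReyna2011_prop51_hasSum`.  The analytic-continuation hypothesis is
typed as: `F` analytic at `1` and `F(s) = s·∫₁^∞ f x^{−s−1}` (tree `Landau.mellinIoi`) for `Re s > 1` near
`1`.  `-- TODO(general form): complex-valued f (the printed generality); only real f is used (Thm 5.1).`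
[cite: AriasDeReyna2011KeiperLi, Proposition 5.1 p.15] -/
theorem _root_.Literature.NumberTheory.LFunctions.AriasDeReyna2011_prop51 {f : ℝ → ℝ} (hf : Measurable f)
    (hint : ∀ n : ℕ, IntegrableOn (fun x ↦ f x * Real.log x ^ n * x ^ (-2 : ℝ)) (Ioi 1))
    {F : ℂ → ℂ} (hF1 : AnalyticAt ℂ F 1)
    (hF : ∃ r > 0, ∀ s : ℂ, 1 < s.re → dist s 1 < r → F s = s * mellinIoi f s) (n : ℕ) :
    iteratedDeriv n (F ∘ liMap) 0 / (n ! : ℂ) =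
      ((∫ t in Ioi (0 : ℝ), f (Real.exp t) * (laguerre 0 n).eval t * Real.exp (-t) : ℝ) : ℂ) := by
  set Mt : ℂ → ℂ := fun s ↦ F s / s with hMt
  have hMt1 : AnalyticAt ℂ Mt 1 := hF1.div analyticAt_id one_ne_zero
  have hder : ∀ j, iteratedDeriv j Mt 1 = mellinIoiLog f j 1 :=
    fun j ↦ iteratedDeriv_div_eq_mellinIoiLog hf hint hF1 hF j
  -- the `n`-th derivative of `F ∘ liMap` at `0` is that of `sⁿ Mt(s)` at `1`
  have hkey : iteratedDeriv n (F ∘ liMap) 0 = iteratedDeriv n (fun s ↦ s ^ n * Mt s) 1 := by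
    rw [← iteratedDeriv_pow_mul_eq_iteratedDeriv_comp_liMap n hF1]
    rcases Nat.eq_zero_or_pos n with hn | hn
    · subst hn; simp [hMt]
    · refine Filter.EventuallyEq.iteratedDeriv_eq n ?_
      filter_upwards [isOpen_ne.mem_nhds (one_ne_zero : (1 : ℂ) ≠ 0)] with s hs
      simp only [hMt]
      obtain ⟨k, rfl⟩ := Nat.exists_eq_add_of_lt hn
      rw [show 0 + k + 1 - 1 = k by omega, pow_succ]
      field_simp
      ring
  -- Leibniz + the values `Mt⁽ʲ⁾(1) = (−1)ʲ ∫ f (log x)ʲ x⁻²`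
  set I : ℕ → ℝ := fun j ↦ ∫ x in Ioi (1 : ℝ), f x * Real.log x ^ j * x ^ (-2 : ℝ) with hI
  have hm : ∀ j ≤ n, iteratedDeriv j Mt 1 = ((-1 : ℂ) ^ j * (I j : ℂ)) := by
    intro j _
    rw [hder j, show (1 : ℂ) = ((1 : ℝ) : ℂ) by simp, mellinIoiLog_ofReal']
    push_cast
    norm_num [hI]
  have hcd : ContDiffAt ℂ n Mt 1 := hMt1.contDiffAt
  rw [hkey, iteratedDeriv_pow_mul_div_factorial hcd _ hm,
    integral_exp_laguerre_eq, integral_mul_laguerre_log_eq_sum hint n]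
  push_cast
  refine Finset.sum_congr rfl fun j _ ↦ ?_
  simp only [hI]
  ring

/-- RH-FREE, PROVED — **[AriasDeReyna2011KeiperLi] Proposition 5.1 p.15, the expansion itself**: under the
hypotheses of `AriasDeReyna2011_prop51`, for `z` near `0`,
`F(1/(1−z)) = Σ_{n≥0} (∫₀^∞ f(eᵗ) L_n(t) e^{−t} dt) zⁿ`. [cite: AriasDeReyna2011KeiperLi, Proposition 5.1 p.15] -/
theorem _root_.Literature.NumberTheory.LFunctions.AriasDeReyna2011_prop51_hasSum {f : ℝ → ℝ}
    (hf : Measurable f)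
    (hint : ∀ n : ℕ, IntegrableOn (fun x ↦ f x * Real.log x ^ n * x ^ (-2 : ℝ)) (Ioi 1))
    {F : ℂ → ℂ} (hF1 : AnalyticAt ℂ F 1)
    (hF : ∃ r > 0, ∀ s : ℂ, 1 < s.re → dist s 1 < r → F s = s * mellinIoi f s) :
    ∀ᶠ z in 𝓝 (0 : ℂ), HasSum (fun n ↦
      ((∫ t in Ioi (0 : ℝ), f (Real.exp t) * (laguerre 0 n).eval t * Real.exp (-t) : ℝ) : ℂ) * z ^ n)
      (F (liMap z)) := by
  have hA : AnalyticAt ℂ (F ∘ liMap) 0 := by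
    have h : AnalyticAt ℂ F (liMap 0) := by rw [liMap_zero]; exact hF1
    exact h.comp (analyticAt_liMap zero_ne_one)
  obtain ⟨r, hr0, hr⟩ := Metric.isOpen_iff.1 (isOpen_analyticAt ℂ (F ∘ liMap)) 0 hA
  have hd : DifferentiableOn ℂ (F ∘ liMap) (Metric.ball 0 r) :=
    fun z hz ↦ (hr hz).differentiableAt.differentiableWithinAt
  filter_upwards [Metric.ball_mem_nhds (0 : ℂ) hr0] with z hz
  have hT := Complex.hasSum_taylorSeries_on_ball hd hz
  refine hT.congr_fun fun n ↦ ?_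
  simp only [smul_eq_mul, sub_zero]
  rw [← AriasDeReyna2011_prop51 hf hint hF1 hF n]
  ring

/-! ## Riemann's `Π(x)` and the prime number theorem with remainder `O(x / logᴬ x)` -/

/-- RH-FREE (definition).  Riemann's prime-power counting function `Π(x) = Σ_{pᵐ ≤ x} 1/m = Σ_{n ≤ x} Λ(n)/log n`
([AriasDeReyna2011KeiperLi] (18); the expression used by the tree's `PiOmega` file).
[cite: AriasDeReyna2011KeiperLi, eq. (18) p.17] -/
def primePowerPi (x : ℝ) : ℝ := ∑ n ∈ Finset.Ioc 0 ⌊x⌋₊, ArithmeticFunction.vonMangoldt n / Real.log n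

/-- `Π` is measurable. [cite: AriasDeReyna2011KeiperLi, eq. (18) p.17] -/
theorem measurable_primePowerPi : Measurable primePowerPi := PiOmega.measurable_primePowerPi

/-- `0 ≤ Π(x) ≤ x` for `x ≥ 0`. [cite: AriasDeReyna2011KeiperLi, eq. (18) p.17] -/
theorem primePowerPi_nonneg_le {x : ℝ} (hx : 0 ≤ x) : 0 ≤ primePowerPi x ∧ primePowerPi x ≤ x :=
  ⟨PiOmega.primePowerPi_nonneg x, PiOmega.primePowerPi_le hx⟩

/-- `0 ≤ Π(x) − π(x) ≤ 2√x log x/log 2` (`x ≥ 1`). [cite: MontgomeryVaughan2007, proof of Thm 15.2 («π(x) = Π(x) + O(x^{1/2}/log x)»)] -/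
theorem primePowerPi_sub_primeCounting_bounds {x : ℝ} (hx : 1 ≤ x) :
    0 ≤ primePowerPi x - (Nat.primeCounting ⌊x⌋₊ : ℝ) ∧
      primePowerPi x - (Nat.primeCounting ⌊x⌋₊ : ℝ) ≤ 2 * Real.sqrt x * Real.log x / Real.log 2 :=
  ⟨PiOmega.primePowerPi_sub_primeCounting_nonneg x, PiOmega.primePowerPi_sub_primeCounting_le_sqrt hx⟩

/-- **The prime number theorem with remainder `O(x/logᴬ x)`, `π − li` form** (de la Vallée Poussin, weak
form): for every `A`, `π(x) − li(x) = O(x/(log x)ᴬ)` — from the tree's `ϑ`-form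
`ChebyshevThetaDeLaValleePoussin_holds.logPow` through MV (13.5)
`π(x) − li x = (ϑ(x) − x)/log x + ∫₂ˣ (ϑ(u) − u) du/(u log² u) + const`.
[cite: MontgomeryVaughan2007, Theorem 6.9 with (13.5)] -/
theorem primeCounting_sub_logIntegral_isBigO_logPow (A : ℕ) :
    (fun x : ℝ ↦ (Nat.primeCounting ⌊x⌋₊ : ℝ) - logIntegral x) =O[atTop]
      fun x ↦ x / Real.log x ^ A := by
  obtain ⟨C, hC⟩ := ChebyshevThetaDeLaValleePoussin_holds.logPow (A + 1 : ℕ)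
  have hC' : ∀ t : ℝ, 2 ≤ t → |θ t - t| ≤ C * t / Real.log t ^ (A + 1) := by
    intro t ht
    have h := hC t ht
    rwa [Real.rpow_natCast] at h
  have hC0 : 0 ≤ C := by
    have h := (abs_nonneg _).trans (hC' 2 le_rfl)
    have hl : 0 < Real.log 2 := Real.log_pos one_lt_two
    rw [le_div_iff₀ (by positivity)] at h
    nlinarith
  -- the target dominates `1` eventually
  have hH : Tendsto (fun x : ℝ ↦ x / Real.log x ^ A) atTop atTop := by
    refine (tendsto_self_mul_inv_log_pow_atTop A).congr' ?_
    filter_upwards with x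
    rw [div_eq_mul_inv, inv_pow]
  have hH1 : ∀ᶠ x : ℝ in atTop, 1 ≤ x / Real.log x ^ A := hH.eventually_ge_atTop 1
  -- (i) the boundary term
  have h1 : (fun x ↦ (θ x - x) / Real.log x) =O[atTop] fun x ↦ x / Real.log x ^ A := by
    refine IsBigO.of_bound C ?_
    filter_upwards [eventually_ge_atTop (Real.exp 1)] with x hx
    have he : (2 : ℝ) ≤ Real.exp 1 := by have := Real.add_one_le_exp (1 : ℝ); linarith
    have hx2 : 2 ≤ x := he.trans hx
    have hlx1 : 1 ≤ Real.log x := by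
      rw [← Real.log_exp 1]; exact Real.log_le_log (Real.exp_pos 1) hx
    have hlx : 0 < Real.log x := by linarith
    have hx0 : 0 < x := by linarith
    rw [Real.norm_eq_abs, Real.norm_eq_abs, abs_div, abs_of_pos hlx,
      abs_of_pos (show 0 < x / Real.log x ^ A by positivity)]
    calc |θ x - x| / Real.log x ≤ (C * x / Real.log x ^ (A + 1)) / Real.log x := by
          gcongr; exact hC' x hx2
      _ = C * (x / Real.log x ^ A) * (1 / Real.log x ^ 2) := by
          field_simp
          ring
      _ ≤ C * (x / Real.log x ^ A) * 1 := by
          gcongr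
          exact (div_le_one (by positivity)).mpr (one_le_pow₀ hlx1)
      _ = C * (x / Real.log x ^ A) := mul_one _
  -- (ii) the integral term, through `Li_{A+3} x = ∫₂ˣ du/log^{A+3} u = O(x / log^{A+3} x)`
  have h2 : (fun x ↦ ∫ t in (2 : ℝ)..x, (θ t - t) / (t * Real.log t ^ 2)) =O[atTop]
      fun x ↦ x / Real.log x ^ A := by
    have hO := VonKochTransfer.isBigO_intervalIntegral_of_abs_le (T := 2) (C := C)
      (g := fun t ↦ (θ t - t) / (t * Real.log t ^ 2)) (h := fun t ↦ (Real.log t)⁻¹ ^ (A + 3))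
      (H := offsetLogIntegralPow (A + 3)) le_rfl hC0
      (fun x hx ↦ VonKochTransfer.intervalIntegrable_theta_sub_div (by linarith))
      ((continuousOn_inv_log_pow (A + 3)).mono fun t (ht : 2 ≤ t) ↦ by
        show 1 < t; linarith) ?_ ?_ ?_
    · refine hO.trans ?_
      have hE := (isEquivalent_offsetLogIntegralPow_holds (A + 3)).isBigO
      refine hE.trans ?_
      refine IsBigO.of_bound 1 ?_
      filter_upwards [eventually_ge_atTop (Real.exp 1)] with x hx
      have hx1 : 1 ≤ Real.log x := by
        rw [← Real.log_exp 1]; exact Real.log_le_log (Real.exp_pos 1) hx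
      have hx0 : 0 < x := (Real.exp_pos 1).trans_le hx
      rw [Real.norm_of_nonneg (by positivity), Real.norm_of_nonneg (by positivity), one_mul]
      exact div_le_div_of_nonneg_left hx0.le (by positivity)
        (pow_le_pow_right₀ hx1 (by omega))
    · intro t ht
      have ht0 : 0 < t := by linarith
      have hlt : 0 < Real.log t := Real.log_pos (by linarith)
      rw [abs_div, abs_mul, abs_of_pos ht0, abs_of_pos (pow_pos hlt 2), div_le_iff₀ (by positivity)]
      calc |θ t - t| ≤ C * t / Real.log t ^ (A + 1) := hC' t ht
        _ = C * (Real.log t)⁻¹ ^ (A + 3) * (t * Real.log t ^ 2) := by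
          rw [inv_pow]
          field_simp
          ring
    · intro x hx
      simp only [offsetLogIntegralPow]
      rfl
    · exact (tendsto_offsetLogIntegralPow_atTop (A + 3)).eventually_ge_atTop 1
  -- (iii) the constant
  have h3 : (fun _ : ℝ ↦ 2 / Real.log 2 - logIntegral 2) =O[atTop] fun x ↦ x / Real.log x ^ A := by
    refine IsBigO.of_bound |2 / Real.log 2 - logIntegral 2| ?_
    filter_upwards [hH1, eventually_ge_atTop (2 : ℝ)] with x hx hx2
    rw [Real.norm_eq_abs, Real.norm_of_nonneg (by positivity)]
    exact le_mul_of_one_le_right (abs_nonneg _) hx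
  refine ((h1.add h2).add h3).congr' ?_ EventuallyEq.rfl
  filter_upwards [eventually_ge_atTop (2 : ℝ)] with x hx
  exact (VonKochTransfer.primeCounting_sub_logIntegral_eq hx).symm

/-- `Π(x) − li(x) = O(x/logᴬ x)` in the form needed: an explicit threshold and constant.
[cite: AriasDeReyna2011KeiperLi, proof of Theorem 5.1 p.17] -/
theorem exists_abs_primeCounting_sub_logIntegral_le (A : ℕ) :
    ∃ X C : ℝ, 2 ≤ X ∧ 0 ≤ C ∧ ∀ x, X ≤ x →
      |(Nat.primeCounting ⌊x⌋₊ : ℝ) - logIntegral x| ≤ C * (x / Real.log x ^ A) := by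
  obtain ⟨C, hC0, hC⟩ := (primeCounting_sub_logIntegral_isBigO_logPow A).exists_nonneg
  obtain ⟨X, hX⟩ := eventually_atTop.mp (hC.bound.and (eventually_ge_atTop (2 : ℝ)))
  refine ⟨max X 2, C, le_max_right _ _, hC0, fun x hx ↦ ?_⟩
  obtain ⟨h, hx2⟩ := hX x ((le_max_left _ _).trans hx)
  rwa [Real.norm_eq_abs, Real.norm_of_nonneg (by
    have : 0 < Real.log x := Real.log_pos (by linarith)
    positivity)] at h

/-! ## The hypothesis of Prop 5.1 for `f = Π − li` -/

/-- `x ↦ π(x)` (real-valued) is monotone. [folklore] -/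
private theorem monotone_primeCounting_real : Monotone fun t : ℝ ↦ (Nat.primeCounting ⌊t⌋₊ : ℝ) := by
  intro a b hab
  show (Nat.primeCounting ⌊a⌋₊ : ℝ) ≤ Nat.primeCounting ⌊b⌋₊
  exact_mod_cast Nat.monotone_primeCounting (Nat.floor_le_floor hab)

/-- `x ↦ π(x)` (real-valued) is measurable. [folklore] -/
private theorem measurable_primeCounting_real : Measurable fun t : ℝ ↦ (Nat.primeCounting ⌊t⌋₊ : ℝ) :=
  monotone_primeCounting_real.measurable

/-- `(log x)ᵐ x^{−3/2}` is integrable on `(1, ∞)` (`= ∫₀^∞ tᵐ e^{−t/2} dt`). [folklore] -/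
private theorem integrableOn_logpow_mul_rpow_neg_three_halves (m : ℕ) :
    IntegrableOn (fun x : ℝ ↦ Real.log x ^ m * x ^ (-(3 / 2 : ℝ))) (Ioi 1) := by
  rw [LogIntegralLaplace.integrableOn_Ioi_one_iff_integrableOn_exp]
  have h := integrableOn_rpow_mul_exp_neg_mul_rpow (s := m) (p := 1) (b := 1 / 2)
    (by have : (0 : ℝ) ≤ m := m.cast_nonneg; linarith) le_rfl (by norm_num)
  refine h.congr_fun (fun t (ht : 0 < t) ↦ ?_) measurableSet_Ioi
  dsimp only
  rw [Real.log_exp, Real.rpow_natCast, Real.rpow_one, ← Real.exp_mul]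
  have : Real.exp t * Real.exp (t * -(3 / 2 : ℝ)) = Real.exp (-(1 / 2) * t) := by
    rw [← Real.exp_add]; ring_nf
  calc t ^ m * Real.exp (-(1 / 2) * t) = t ^ m * (Real.exp t * Real.exp (t * -(3 / 2 : ℝ))) := by
        rw [this]
    _ = Real.exp t * (t ^ m * Real.exp (t * -(3 / 2 : ℝ))) := by ring

/-- `1/(x log² x)` is integrable on `(X, ∞)` for `X > 1` (antiderivative `−1/log x`). [folklore] -/
private theorem integrableOn_inv_mul_log_sq {X : ℝ} (hX : 1 < X) :
    IntegrableOn (fun x : ℝ ↦ 1 / (x * Real.log x ^ 2)) (Ioi X) := by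
  have hderiv : ∀ x ∈ Ici X, HasDerivAt (fun x ↦ -(Real.log x)⁻¹) (1 / (x * Real.log x ^ 2)) x := by
    intro x hx
    have hx1 : 1 < x := hX.trans_le hx
    have hx0 : x ≠ 0 := by positivity
    have hl : Real.log x ≠ 0 := (Real.log_pos hx1).ne'
    have h := ((Real.hasDerivAt_log hx0).inv hl).neg
    refine h.congr_deriv ?_
    field_simp
  refine integrableOn_Ioi_deriv_of_nonneg (l := 0) ?_
    (fun x (hx : X < x) ↦ hderiv x (show X ≤ x from hx.le)) (fun x (hx : X < x) ↦ ?_) ?_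
  · exact ((hderiv X Set.self_mem_Ici).continuousAt).continuousWithinAt
  · have hx1 : 1 < x := hX.trans hx
    have : 0 < Real.log x := Real.log_pos hx1
    positivity
  · simpa using (Real.tendsto_log_atTop.inv_tendsto_atTop).neg

/-- **`Π − li` satisfies the hypothesis of Prop 5.1**: `{Π(x) − li(x)} x⁻² (log x)ⁿ ∈ L¹(1,∞)` for every
`n` («The estimate of the remainder in the Prime Number Theorem `|Π(x) − Li(x)| ≤ Cx e^{−c√log x}` implies
that `f` satisfies the hypothesis of Proposition 5.1»; near `x = 1` the logarithmic singularity of `li` is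
integrable). [cite: AriasDeReyna2011KeiperLi, proof of Theorem 5.1 p.17] -/
theorem integrableOn_primePowerPi_sub_logIntegral (n : ℕ) :
    IntegrableOn (fun x ↦ (primePowerPi x - logIntegral x) * Real.log x ^ n * x ^ (-2 : ℝ)) (Ioi 1) := by
  obtain ⟨X, C, hX2, hC0, hC⟩ := exists_abs_primeCounting_sub_logIntegral_le (n + 2)
  have hX1 : 1 < X := by linarith
  have hmeas : Measurable fun x ↦ (primePowerPi x - logIntegral x) * Real.log x ^ n * x ^ (-2 : ℝ) :=
    ((measurable_primePowerPi.sub measurable_logIntegral).mul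
      (Real.measurable_log.pow_const n)).mul (measurable_id.pow_const _)
  -- split `f = (Π − π) + (π − li)` and `(1,∞) = (1,X] ∪ (X,∞)`
  have hsplit : Ioi (1 : ℝ) = Ioc 1 X ∪ Ioi X := (Ioc_union_Ioi_eq_Ioi hX1.le).symm
  -- (a) the `Π − π` part on all of `(1,∞)`: `≤ (2/log 2) (log x)^{n+1} x^{−3/2}`
  have hA : IntegrableOn (fun x ↦ (primePowerPi x - (Nat.primeCounting ⌊x⌋₊ : ℝ)) *
      Real.log x ^ n * x ^ (-2 : ℝ)) (Ioi 1) := by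
    have hb := (integrableOn_logpow_mul_rpow_neg_three_halves (n + 1)).const_mul (2 / Real.log 2)
    refine Integrable.mono' hb ?_ ?_
    · exact (((measurable_primePowerPi.sub measurable_primeCounting_real).mul
        (Real.measurable_log.pow_const n)).mul (measurable_id.pow_const _)).aestronglyMeasurable
    · rw [ae_restrict_iff' measurableSet_Ioi]
      refine Eventually.of_forall fun x (hx : 1 < x) ↦ ?_
      have hx0 : 0 < x := by linarith
      obtain ⟨h0, h1⟩ := primePowerPi_sub_primeCounting_bounds hx.le
      have hl : 0 ≤ Real.log x := Real.log_nonneg hx.le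
      have hl2 : 0 < Real.log 2 := Real.log_pos one_lt_two
      rw [Real.norm_eq_abs, abs_mul, abs_mul, abs_of_nonneg h0, abs_of_nonneg (pow_nonneg hl n),
        abs_of_pos (Real.rpow_pos_of_pos hx0 _)]
      have hsq : Real.sqrt x * x ^ (-2 : ℝ) = x ^ (-(3 / 2 : ℝ)) := by
        rw [Real.sqrt_eq_rpow, ← Real.rpow_add hx0]; norm_num
      calc (primePowerPi x - (Nat.primeCounting ⌊x⌋₊ : ℝ)) * Real.log x ^ n * x ^ (-2 : ℝ)
          ≤ (2 * Real.sqrt x * Real.log x / Real.log 2) * Real.log x ^ n * x ^ (-2 : ℝ) := by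
            gcongr
        _ = 2 / Real.log 2 * (Real.log x ^ (n + 1) * (Real.sqrt x * x ^ (-2 : ℝ))) := by
            rw [pow_succ]; field_simp
        _ = 2 / Real.log 2 * (Real.log x ^ (n + 1) * x ^ (-(3 / 2 : ℝ))) := by rw [hsq]
  -- (b) the `π − li` part on `(1, X]`: `π` bounded, `li ∈ L¹(1,X]`, `(log x)ⁿ x⁻² ≤ (log X)ⁿ`
  have hB1 : IntegrableOn (fun x ↦ ((Nat.primeCounting ⌊x⌋₊ : ℝ) - logIntegral x) *
      Real.log x ^ n * x ^ (-2 : ℝ)) (Ioc 1 X) := by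
    have hπ : IntegrableOn (fun x ↦ (Nat.primeCounting ⌊x⌋₊ : ℝ)) (Ioc 1 X) :=
      (monotone_primeCounting_real.locallyIntegrable.integrableOn_isCompact isCompact_Icc).mono_set
        Ioc_subset_Icc_self
    have hdiff : IntegrableOn (fun x ↦ (Nat.primeCounting ⌊x⌋₊ : ℝ) - logIntegral x) (Ioc 1 X) :=
      hπ.sub (LogIntegralLaplace.integrableOn_logIntegral_Ioc X)
    have hcont : ContinuousOn (fun x : ℝ ↦ Real.log x ^ n * x ^ (-2 : ℝ)) (Icc 1 X) := by
      refine ContinuousOn.mul ((Real.continuousOn_log.mono fun t ht ↦ ?_).pow n)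
        (ContinuousOn.rpow_const continuousOn_id fun t ht ↦ Or.inl ?_)
      · show t ≠ 0
        have : (1 : ℝ) ≤ t := ht.1
        positivity
      · have : (1 : ℝ) ≤ t := ht.1
        show id t ≠ 0
        simp only [id]; positivity
    have h0 : IntegrableOn (fun x ↦ (Nat.primeCounting ⌊x⌋₊ : ℝ) - logIntegral x) (Icc 1 X) := by
      rw [integrableOn_Icc_iff_integrableOn_Ioc]; exact hdiff
    have h := h0.mul_continuousOn hcont isCompact_Icc
    refine (h.mono_set Ioc_subset_Icc_self).congr_fun (fun x _ ↦ ?_) measurableSet_Ioc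
    ring
  -- (c) the `π − li` part on `(X, ∞)`: `≤ C/(x log² x)`
  have hB2 : IntegrableOn (fun x ↦ ((Nat.primeCounting ⌊x⌋₊ : ℝ) - logIntegral x) *
      Real.log x ^ n * x ^ (-2 : ℝ)) (Ioi X) := by
    have hb := (integrableOn_inv_mul_log_sq hX1).const_mul C
    refine Integrable.mono' hb ?_ ?_
    · exact (((measurable_primeCounting_real.sub measurable_logIntegral).mul
        (Real.measurable_log.pow_const n)).mul (measurable_id.pow_const _)).aestronglyMeasurable
    · rw [ae_restrict_iff' measurableSet_Ioi]
      refine Eventually.of_forall fun x (hx : X < x) ↦ ?_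
      have hx1 : 1 < x := hX1.trans hx
      have hx0 : 0 < x := by linarith
      have hl : 0 < Real.log x := Real.log_pos hx1
      rw [Real.norm_eq_abs, abs_mul, abs_mul, abs_of_nonneg (pow_nonneg hl.le n),
        abs_of_pos (Real.rpow_pos_of_pos hx0 _)]
      have hx2 : x ^ (-2 : ℝ) = 1 / x ^ 2 := by
        rw [Real.rpow_neg hx0.le, show (2 : ℝ) = (2 : ℕ) by norm_num, Real.rpow_natCast, one_div]
      calc |(Nat.primeCounting ⌊x⌋₊ : ℝ) - logIntegral x| * Real.log x ^ n * x ^ (-2 : ℝ)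
          ≤ C * (x / Real.log x ^ (n + 2)) * Real.log x ^ n * x ^ (-2 : ℝ) := by
            gcongr; exact hC x hx.le
        _ = C * (1 / (x * Real.log x ^ 2)) := by rw [hx2]; field_simp; ring
  have hB : IntegrableOn (fun x ↦ ((Nat.primeCounting ⌊x⌋₊ : ℝ) - logIntegral x) *
      Real.log x ^ n * x ^ (-2 : ℝ)) (Ioi 1) := by
    rw [hsplit]; exact hB1.union hB2
  refine (hA.add hB).congr_fun (fun x _ ↦ ?_) measurableSet_Ioi
  simp only [Pi.add_apply]
  ring

/-! ## Eq. (21): `log{(s−1)ζ(s)} = s ∫₁^∞ {Π(x) − li(x)} x^{−s−1} dx` -/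

/-- `ζ(σ)` is a positive real number for real `σ > 1`. [folklore] -/
private theorem riemannZeta_ofReal_eq {σ : ℝ} (hσ : 1 < σ) :
    ∃ y : ℝ, 0 < y ∧ riemannZeta (σ : ℂ) = (y : ℂ) := by
  have hs : 1 < (σ : ℂ).re := by simpa using hσ
  refine ⟨(riemannZeta σ).re, ?_, ?_⟩
  · -- `Re ζ(σ) ≥ ... > 0`: compare with the Dirichlet series termwise
    rw [zeta_eq_tsum_one_div_nat_cpow hs, Complex.re_tsum (Complex.summable_one_div_nat_cpow.mpr hs)]
    have hterm : ∀ n : ℕ, (1 / (n : ℂ) ^ (σ : ℂ)).re = 1 / (n : ℝ) ^ σ := by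
      intro n
      rw [← Complex.ofReal_natCast, ← Complex.ofReal_cpow n.cast_nonneg, ← Complex.ofReal_one,
        ← Complex.ofReal_div, Complex.ofReal_re]
    simp_rw [hterm]
    have hsum : Summable fun n : ℕ ↦ 1 / (n : ℝ) ^ σ := Real.summable_one_div_nat_rpow.mpr hσ
    refine hsum.tsum_pos (fun n ↦ by positivity) 1 (by simp)
  · apply Complex.ext
    · simp
    · rw [Complex.ofReal_im]
      have h := riemannZeta_conj (σ : ℂ)
      rw [Complex.conj_ofReal] at h
      -- `conj ζ(σ) = ζ(σ)` forces `Im ζ(σ) = 0`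
      have := congrArg Complex.im h
      rw [Complex.conj_im] at this
      linarith

/-- **The Dirichlet series of `log ζ`**: for real `σ > 1`,
`log ζ₁(σ) = Σ_n Λ(n)/(log n) n^{−σ} + log(σ − 1)` where `ζ₁(s) = (s−1)ζ(s)` (principal `log` of a positive
real).  Proof: both sides have the same derivative `ζ₁'/ζ₁(σ)` on `(1,∞)` (tree
`PiOmega.hasDerivAt_LSeries_coeff`: `D' = ζ'/ζ`) and both tend to `0` as `σ → ∞`.
[cite: MontgomeryVaughan2007, Theorem 1.3 («log ζ(s) = Σ Λ(n)/(log n) n^{−s}»)] -/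
theorem log_riemannZeta₁_ofReal_eq {σ : ℝ} (hσ : 1 < σ) :
    Complex.log (riemannZeta₁ (σ : ℂ)) =
      LSeries (fun n : ℕ ↦ ((ArithmeticFunction.vonMangoldt n / Real.log n : ℝ) : ℂ)) σ +
        Complex.log ((σ : ℂ) - 1) := by
  set c : ℕ → ℂ := fun n : ℕ ↦ ((ArithmeticFunction.vonMangoldt n / Real.log n : ℝ) : ℂ) with hc
  -- `G(σ) = D(σ) + log(σ−1) − log ζ₁(σ)` on `(1,∞)`
  set G : ℝ → ℂ := fun σ ↦ LSeries c σ + Complex.log ((σ : ℂ) - 1) -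
    Complex.log (riemannZeta₁ (σ : ℂ)) with hG
  -- positivity facts at a real point `τ > 1`
  have hfacts : ∀ τ : ℝ, 1 < τ → riemannZeta (τ : ℂ) ≠ 0 ∧ (τ : ℂ) ≠ 1 ∧
      riemannZeta₁ (τ : ℂ) ∈ Complex.slitPlane ∧ ((τ : ℂ) - 1) ∈ Complex.slitPlane := by
    intro τ hτ
    obtain ⟨y, hy0, hy⟩ := riemannZeta_ofReal_eq hτ
    have hτ1 : (τ : ℂ) ≠ 1 := by
      intro h; have := congrArg Complex.re h; simp at this; linarith
    refine ⟨by rw [hy]; exact_mod_cast hy0.ne', hτ1, ?_, ?_⟩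
    · rw [riemannZeta₁_eq_mul hτ1, hy, ← Complex.ofReal_one, ← Complex.ofReal_sub, ← Complex.ofReal_mul]
      exact Complex.ofReal_mem_slitPlane.mpr (mul_pos (by linarith) hy0)
    · rw [← Complex.ofReal_one, ← Complex.ofReal_sub]
      exact Complex.ofReal_mem_slitPlane.mpr (by linarith)
  -- `G' = 0` on `(1, ∞)`
  have hderiv : ∀ τ : ℝ, 1 < τ → HasDerivAt G 0 τ := by
    intro τ hτ
    obtain ⟨hζ, hτ1, hsl1, hsl2⟩ := hfacts τ hτ
    have hre : 1 < (τ : ℂ).re := by simpa using hτ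
    -- `D' = ζ'/ζ`
    have h1 : HasDerivAt (fun σ : ℝ ↦ LSeries c (σ : ℂ))
        (deriv riemannZeta (τ : ℂ) / riemannZeta (τ : ℂ)) τ := by
      exact (PiOmega.hasDerivAt_LSeries_coeff hre).comp_ofReal
    -- `(log(σ−1))' = 1/(σ−1)`
    have h2 : HasDerivAt (fun σ : ℝ ↦ Complex.log ((σ : ℂ) - 1)) (1 / ((τ : ℂ) - 1)) τ := by
      have h : HasDerivAt (fun s : ℂ ↦ Complex.log (s - 1)) ((1 : ℂ) * ((τ : ℂ) - 1)⁻¹) (τ : ℂ) :=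
        ((hasDerivAt_id (τ : ℂ)).sub_const 1).clog hsl2
      simpa [one_div] using h.comp_ofReal
    -- `(log ζ₁)' = ζ₁'/ζ₁ = ζ'/ζ + 1/(σ−1)`
    have h3 : HasDerivAt (fun σ : ℝ ↦ Complex.log (riemannZeta₁ (σ : ℂ)))
        (deriv riemannZeta₁ (τ : ℂ) / riemannZeta₁ (τ : ℂ)) τ := by
      have h : HasDerivAt (fun s : ℂ ↦ Complex.log (riemannZeta₁ s))
          (deriv riemannZeta₁ (τ : ℂ) * (riemannZeta₁ (τ : ℂ))⁻¹) (τ : ℂ) :=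
        (differentiable_riemannZeta₁ _).hasDerivAt.clog hsl1
      simpa [div_eq_mul_inv] using h.comp_ofReal
    have hlogd : deriv riemannZeta₁ (τ : ℂ) / riemannZeta₁ (τ : ℂ) =
        deriv riemannZeta (τ : ℂ) / riemannZeta (τ : ℂ) + 1 / ((τ : ℂ) - 1) := by
      have h := logDeriv_riemannZeta_eq hτ1 hζ
      rw [logDeriv_apply, logDeriv_apply] at h
      rw [h, one_div]
      ring
    have h := (h1.add h2).sub h3
    rw [hlogd] at h
    refine h.congr_deriv ?_
    ring
  -- hence `G` is constant on `(1, ∞)`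
  have hconst : ∀ a b : ℝ, 1 < a → a ≤ b → G b = G a := by
    intro a b ha hab
    have hcont : ContinuousOn G (Icc a b) := fun x hx ↦
      (hderiv x (ha.trans_le hx.1)).continuousAt.continuousWithinAt
    exact constant_of_has_deriv_right_zero hcont
      (fun x hx ↦ (hderiv x (ha.trans_le hx.1)).hasDerivWithinAt) b (right_mem_Icc.mpr hab)
  -- and `G(σ) → 0` as `σ → ∞`
  have hlim : Tendsto G atTop (𝓝 0) := by
    -- `D(σ) → c 1 = 0`
    have hD : Tendsto (fun σ : ℝ ↦ LSeries c σ) atTop (𝓝 0) := by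
      have h := LSeries.tendsto_atTop (f := c)
        (lt_of_le_of_lt PiOmega.abscissaOfAbsConv_coeff_le_one (EReal.coe_lt_top _))
      have hc1 : c 1 = 0 := by simp [hc]
      rwa [hc1] at h
    -- `log(σ−1) − log ζ₁(σ) = −log ζ(σ) → 0`
    have hZ : Tendsto (fun σ : ℝ ↦ Complex.log ((σ : ℂ) - 1) - Complex.log (riemannZeta₁ (σ : ℂ)))
        atTop (𝓝 0) := by
      have hζlim : Tendsto (fun σ : ℝ ↦ riemannZeta (σ : ℂ)) atTop (𝓝 1) := by
        have h := LSeries.tendsto_atTop (f := (1 : ℕ → ℂ))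
          (by rw [LSeries.abscissaOfAbsConv_one]; exact EReal.coe_lt_top _)
        simp only [Pi.one_apply] at h
        refine (h.congr' ?_)
        filter_upwards [eventually_gt_atTop (1 : ℝ)] with σ hσ
        exact LSeries_one_eq_riemannZeta (by simpa using hσ)
      have hlog : Tendsto (fun σ : ℝ ↦ -Complex.log (riemannZeta (σ : ℂ))) atTop (𝓝 0) := by
        have := ((continuousAt_clog Complex.one_mem_slitPlane).tendsto.comp hζlim).neg
        simpa using this
      refine hlog.congr' ?_
      filter_upwards [eventually_gt_atTop (1 : ℝ)] with σ hσ
      obtain ⟨y, hy0, hy⟩ := riemannZeta_ofReal_eq hσ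
      obtain ⟨_, hσ1, _, _⟩ := hfacts σ hσ
      have hσy : 0 < (σ - 1) * y := mul_pos (by linarith) hy0
      rw [riemannZeta₁_eq_mul hσ1, hy, ← Complex.ofReal_one, ← Complex.ofReal_sub, ← Complex.ofReal_mul,
        ← Complex.ofReal_log hy0.le, ← Complex.ofReal_log (x := σ - 1) (by linarith),
        ← Complex.ofReal_log hσy.le, Real.log_mul (by linarith) hy0.ne']
      push_cast
      ring
    have := hD.add hZ
    simp only [add_zero] at this
    refine this.congr' (Eventually.of_forall fun σ ↦ ?_)
    simp only [hG]; ring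
  -- so `G ≡ 0`
  have hG0 : G σ = 0 := by
    have hev : ∀ᶠ b in atTop, G b = G σ := by
      filter_upwards [eventually_ge_atTop σ] with b hb
      exact hconst σ b hσ hb
    have := (tendsto_nhds_unique_of_eventuallyEq hlim tendsto_const_nhds hev)
    exact this.symm
  have : LSeries c σ + Complex.log ((σ : ℂ) - 1) - Complex.log (riemannZeta₁ (σ : ℂ)) = 0 := hG0
  linear_combination -this

/-- `Π − li` in the Landau-lemma currency: `mellinIoi (Π − li) σ = D(σ)/σ + log(σ−1)/σ` for real `σ > 1`.
[cite: AriasDeReyna2011KeiperLi, eq. (21) p.17] -/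
theorem mellinIoi_primePowerPi_sub_logIntegral {σ : ℝ} (hσ : 1 < σ) :
    mellinIoi (fun x ↦ primePowerPi x - logIntegral x) (σ : ℂ) =
      LSeries (fun n : ℕ ↦ ((ArithmeticFunction.vonMangoldt n / Real.log n : ℝ) : ℂ)) σ / σ +
        Complex.log ((σ : ℂ) - 1) / σ := by
  have hre : 1 < (σ : ℂ).re := by simpa using hσ
  have hPi := PiOmega.mellinIoi_primePowerPi hre
  have hli := LogIntegralLaplace.mellinIoi_logIntegral hσ
  -- linearity of the transform (both pieces converge absolutely at `σ`)
  have hσ1' : 1 < (1 + σ) / 2 := by linarith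
  have hs' : (1 + σ) / 2 < ((σ : ℂ)).re := by simp; linarith
  have hlin : mellinIoi (fun x ↦ primePowerPi x - logIntegral x) (σ : ℂ) =
      mellinIoi primePowerPi (σ : ℂ) - mellinIoi logIntegral (σ : ℂ) := by
    simp only [Landau.mellinIoi]
    rw [← integral_sub]
    · refine setIntegral_congr_fun measurableSet_Ioi fun x _ ↦ ?_
      push_cast; ring
    · have h1 := Landau.integrable_mellinIntegrand PiOmega.measurable_primePowerPi
        (PiOmega.integrableOn_primePowerPi_rpow hσ1') 0 hs'
      refine h1.congr (Eventually.of_forall fun x ↦ ?_)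
      simp [Landau.mellinIntegrand, primePowerPi]
    · have h2 := Landau.integrable_mellinIntegrand measurable_logIntegral
        (LogIntegralLaplace.integrableOn_logIntegral_mul_rpow hσ1') 0 hs'
      refine h2.congr (Eventually.of_forall fun x ↦ ?_)
      simp [Landau.mellinIntegrand]
  rw [hlin, show mellinIoi primePowerPi (σ : ℂ) = _ from hPi, hli]
  have hσ0 : (σ : ℂ) ≠ 0 := by exact_mod_cast (by linarith : σ ≠ 0)
  rw [← Complex.ofReal_one, ← Complex.ofReal_sub, ← Complex.ofReal_log (x := σ - 1) (by linarith)]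
  push_cast
  field_simp
  ring

/-- RH-FREE, PROVED — **[AriasDeReyna2011KeiperLi] eq. (21) p.17** («the well-known equality»), at real
`σ > 1`: `log{(σ−1)ζ(σ)} = σ ∫₁^∞ {Π(x) − li(x)} x^{−σ−1} dx` (`log` of the positive real `ζ₁(σ)`;
`∫` = tree `Landau.mellinIoi`).  Complex `s` near `1`: `AriasDeReyna2011_eq21_nhds`.
[cite: AriasDeReyna2011KeiperLi, eq. (21) p.17] -/
theorem _root_.Literature.NumberTheory.LFunctions.AriasDeReyna2011_eq21 {σ : ℝ} (hσ : 1 < σ) :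
    Complex.log (riemannZeta₁ (σ : ℂ)) = σ * mellinIoi (fun x ↦ primePowerPi x - logIntegral x) (σ : ℂ) := by
  rw [mellinIoi_primePowerPi_sub_logIntegral hσ, log_riemannZeta₁_ofReal_eq hσ]
  have hσ0 : (σ : ℂ) ≠ 0 := by exact_mod_cast (by linarith : σ ≠ 0)
  field_simp

/-- RH-FREE, PROVED — **eq. (21) continued to complex `s`**: there is `r > 0` such that
`log ζ₁(s) = s ∫₁^∞ {Π(x) − li(x)} x^{−s−1} dx` for `Re s > 1`, `|s − 1| < r` (identity theorem: both sides are
holomorphic on the convex set `{Re s > 1} ∩ B(1,r)` and agree on its real points).  This is the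
analytic-continuation hypothesis of Prop 5.1 for `F = log ζ₁`. [cite: AriasDeReyna2011KeiperLi, eq. (21) p.17 and proof of Thm 5.1] -/
theorem _root_.Literature.NumberTheory.LFunctions.AriasDeReyna2011_eq21_nhds :
    ∃ r > 0, ∀ s : ℂ, 1 < s.re → dist s 1 < r →
      Complex.log (riemannZeta₁ s) = s * mellinIoi (fun x ↦ primePowerPi x - logIntegral x) s := by
  -- `log ζ₁` is analytic on a ball about `1`
  have hA1 : AnalyticAt ℂ (fun s ↦ Complex.log (riemannZeta₁ s)) 1 :=
    (differentiable_riemannZeta₁.analyticAt 1).clog (by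
      rw [riemannZeta₁_one]; exact Complex.one_mem_slitPlane)
  obtain ⟨r, hr0, hr⟩ := hA1.exists_ball_analyticOnNhd
  refine ⟨r, hr0, fun s hs hsd ↦ ?_⟩
  set f : ℝ → ℝ := fun x ↦ primePowerPi x - logIntegral x with hf
  set U : Set ℂ := {s : ℂ | 1 < s.re} ∩ Metric.ball (1 : ℂ) r with hU
  have hUo : IsOpen U := (Landau.isOpen_re_gt 1).inter Metric.isOpen_ball
  have hUconv : Convex ℝ U := (convex_halfSpace_re_gt 1).inter (convex_ball _ _)
  have hbase := integrableOn_base (f := f) (integrableOn_primePowerPi_sub_logIntegral 0)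
  have hfm : Measurable f := measurable_primePowerPi.sub measurable_logIntegral
  have hg1 : AnalyticOnNhd ℂ (fun s ↦ Complex.log (riemannZeta₁ s)) U := fun z hz ↦ hr z hz.2
  have hg2 : AnalyticOnNhd ℂ (fun s ↦ s * mellinIoi f s) U := by
    have hd : DifferentiableOn ℂ (fun s ↦ s * mellinIoi f s) {s : ℂ | 1 < s.re} :=
      differentiableOn_id.mul (Landau.differentiableOn_mellinIoi hfm hbase)
    exact (hd.mono inter_subset_left).analyticOnNhd hUo
  -- agreement on the real points of `U`, which accumulate at `z₀ = 1 + r/2`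
  set z₀ : ℂ := ((1 + r / 2 : ℝ) : ℂ) with hz₀
  have hz₀U : z₀ ∈ U := by
    refine ⟨by simp [hz₀]; linarith, ?_⟩
    rw [Metric.mem_ball, hz₀, Complex.dist_eq, ← Complex.ofReal_one, ← Complex.ofReal_sub,
      Complex.norm_real, Real.norm_eq_abs, abs_of_pos (by linarith)]
    linarith
  have hfreq : ∃ᶠ z in 𝓝[≠] z₀, Complex.log (riemannZeta₁ z) = z * mellinIoi f z := by
    -- along the real sequence `z₀ + r/(4(k+1))`... we use the real points `σ ∈ (1, 1+r)`, `σ ≠ z₀`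
    have hmap : Tendsto (fun σ : ℝ ↦ (σ : ℂ)) (𝓝[≠] ((1 : ℝ) + r / 2)) (𝓝[≠] z₀) := by
      refine tendsto_nhdsWithin_of_tendsto_nhds_of_eventually_within _
        ((Complex.continuous_ofReal.tendsto _).mono_left nhdsWithin_le_nhds) ?_
      filter_upwards [self_mem_nhdsWithin] with σ (hσ : σ ≠ 1 + r / 2)
      simp only [hz₀, mem_compl_iff, mem_singleton_iff, Complex.ofReal_inj]
      exact hσ
    have hev : ∀ᶠ σ : ℝ in 𝓝[≠] ((1 : ℝ) + r / 2),
        Complex.log (riemannZeta₁ (σ : ℂ)) = (σ : ℂ) * mellinIoi f σ := by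
      have hI : Ioo (1 : ℝ) (1 + r) ∈ 𝓝 ((1 : ℝ) + r / 2) := Ioo_mem_nhds (by linarith) (by linarith)
      filter_upwards [mem_nhdsWithin_of_mem_nhds hI] with σ hσ
      exact AriasDeReyna2011_eq21 hσ.1
    exact Filter.Tendsto.frequently_map _ hmap
      (fun σ (hσ : Complex.log (riemannZeta₁ (σ : ℂ)) = (σ : ℂ) * mellinIoi f σ) ↦ hσ) hev.frequently
  have hEq := hg1.eqOn_of_preconnected_of_frequently_eq hg2 hUconv.isPreconnected hz₀U hfreq
  exact hEq ⟨hs, by simpa [Metric.mem_ball] using hsd⟩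

/-! ## Theorem 5.1 and the integrals (22), (23) -/

/-- RH-FREE, PROVED — **[AriasDeReyna2011KeiperLi] Theorem 5.1, eq. (20) p.17**: for all `n ≥ 0`,
`A_n = ∫₀^∞ {Π(eᵗ) − li(eᵗ)} L_n(t) e^{−t} dt`  (Prop 5.1 applied to `f = Π − li`, `F = log ζ₁` via (21);
`A_n = ariasA n`, `Π = primePowerPi`, `li = logIntegral`, `L_n = laguerre 0 n`).
[cite: AriasDeReyna2011KeiperLi, Theorem 5.1 eq. (20) p.17] -/
theorem _root_.Literature.NumberTheory.LFunctions.AriasDeReyna2011_thm51 (n : ℕ) :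
    ariasA n = ∫ t in Ioi (0 : ℝ), (primePowerPi (Real.exp t) - logIntegral (Real.exp t)) *
      (laguerre 0 n).eval t * Real.exp (-t) := by
  have hA1 : AnalyticAt ℂ (fun s ↦ Complex.log (riemannZeta₁ s)) 1 :=
    (differentiable_riemannZeta₁.analyticAt 1).clog (by
      rw [riemannZeta₁_one]; exact Complex.one_mem_slitPlane)
  have h := AriasDeReyna2011_prop51 (f := fun x ↦ primePowerPi x - logIntegral x)
    (measurable_primePowerPi.sub measurable_logIntegral) integrableOn_primePowerPi_sub_logIntegral
    hA1 AriasDeReyna2011_eq21_nhds n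
  have e : ((fun s ↦ Complex.log (riemannZeta₁ s)) ∘ liMap) =
      fun z ↦ Complex.log (riemannZeta₁ (liMap z)) := rfl
  rw [e, ← ariasA_coe] at h
  exact_mod_cast h

/-- RH-FREE, PROVED — **[AriasDeReyna2011KeiperLi] eq. (22) p.17**: `A_0 = 0 = ∫₀^∞ {Π(eᵗ) − li(eᵗ)} e^{−t} dt`.
[cite: AriasDeReyna2011KeiperLi, eq. (22) p.17] -/
theorem _root_.Literature.NumberTheory.LFunctions.AriasDeReyna2011_eq22 :
    ariasA 0 = 0 ∧
      ∫ t in Ioi (0 : ℝ), (primePowerPi (Real.exp t) - logIntegral (Real.exp t)) * Real.exp (-t) = 0 := by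
  refine ⟨ariasA_zero, ?_⟩
  have h := AriasDeReyna2011_thm51 0
  rw [ariasA_zero] at h
  refine Eq.trans ?_ h.symm
  refine setIntegral_congr_fun measurableSet_Ioi fun t _ ↦ ?_
  simp [laguerre_zero]

/-- RH-FREE, PROVED — **[AriasDeReyna2011KeiperLi] eq. (23) p.17**:
`A_1 = γ = ∫₀^∞ {Π(eᵗ) − li(eᵗ)} (1 − t) e^{−t} dt`. [cite: AriasDeReyna2011KeiperLi, eq. (23) p.17] -/
theorem _root_.Literature.NumberTheory.LFunctions.AriasDeReyna2011_eq23 :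
    ariasA 1 = Real.eulerMascheroniConstant ∧
      ∫ t in Ioi (0 : ℝ), (primePowerPi (Real.exp t) - logIntegral (Real.exp t)) * (1 - t) * Real.exp (-t) =
        Real.eulerMascheroniConstant := by
  refine ⟨ariasA_one, ?_⟩
  have h := AriasDeReyna2011_thm51 1
  rw [ariasA_one] at h
  refine Eq.trans ?_ h.symm
  refine setIntegral_congr_fun measurableSet_Ioi fun t _ ↦ ?_
  simp [laguerre_one]

/-! ## Theorem 5.2: `λ_m` and the primes -/

/-- RH-FREE, PROVED — **[AriasDeReyna2011KeiperLi] Theorem 5.2, eq. (24) p.18** (`m ≥ 2`):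
`λ_m = (log m)/2 − (1 − γ + log 2π)/2 + ∫₀^∞ {Π(eᵗ) − li(eᵗ)} L_m(t) e^{−t} dt − ½{γ + log m − Σ_{j≤m} 1/j}
 + 1/(2m) − I_m/(2m)` — Thm 4.1 + Lemma 4.1 (through (17), tree `AriasDeReyna2011.xSeq_eq`,
`AriasDeReyna2011.ariasI_eq`) + Thm 5.1 (`λ_m = keiperLambdaK m` Keiper's, `I_m = ariasI m`).
[cite: AriasDeReyna2011KeiperLi, Theorem 5.2 eq. (24) p.18] -/
theorem _root_.Literature.NumberTheory.LFunctions.AriasDeReyna2011_thm52 {m : ℕ} (hm : 2 ≤ m) :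
    keiperLambdaK m = Real.log m / 2 - (1 - Real.eulerMascheroniConstant + Real.log (2 * Real.pi)) / 2
      + (∫ t in Ioi (0 : ℝ), (primePowerPi (Real.exp t) - logIntegral (Real.exp t)) *
          (laguerre 0 m).eval t * Real.exp (-t))
      - (1 / 2) * (Real.eulerMascheroniConstant + Real.log m - (harmonic m : ℝ))
      + 1 / (2 * m) - ariasI m / (2 * m) := by
  have hm1 : 1 ≤ m := by omega
  have hdef : AriasDeReyna2011.xSeq m =
      (∫ t in Ioi (0 : ℝ), (primePowerPi (Real.exp t) - logIntegral (Real.exp t)) *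
          (laguerre 0 m).eval t * Real.exp (-t)) - keiperLambdaK m + Real.log m / 2 -
        (Real.log (2 * Real.pi) + 1 - Real.eulerMascheroniConstant) / 2 := by
    rw [AriasDeReyna2011.xSeq, AriasDeReyna2011_thm51 m]
  have hx := AriasDeReyna2011.xSeq_eq hm1
  have hI := AriasDeReyna2011.ariasI_eq hm
  linear_combination hdef - hx + (1 / (2 * (m : ℝ))) * hI

/-! ## Corollary 5.1: RH ⟺ `(Π(x) − li(x))/x ∈ L²(1,∞)` -/

open Literature.Analysis.SpecialFunctions.LaguerreOrthogonality (laguerreFn)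

/-- `e^{−t} = e^{−t/2} e^{−t/2}`. [folklore] -/
private theorem exp_neg_eq_mul_half (t : ℝ) : Real.exp (-t) = Real.exp (-t / 2) * Real.exp (-t / 2) := by
  rw [← Real.exp_add]; ring_nf

/-- Thm 5.1 in Laguerre-function form: `A_n = ∫₀^∞ g(t) ℓ_n(t) dt`, `g(t) = {Π(eᵗ) − li(eᵗ)} e^{−t/2}`,
`ℓ_n = L_n e^{−t/2}` (proof of Cor 5.1: «According to (20), this is equivalent to the function
`{Π(eᵗ) − Li(eᵗ)}e^{−t/2}` being in `L²(0,+∞)`»). [cite: AriasDeReyna2011KeiperLi, proof of Corollary 5.1 p.17] -/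
theorem ariasA_eq_integral_mul_laguerreFn (n : ℕ) :
    ariasA n = ∫ t in Ioi (0 : ℝ), ((primePowerPi (Real.exp t) - logIntegral (Real.exp t)) *
      Real.exp (-t / 2)) * laguerreFn n t := by
  rw [AriasDeReyna2011_thm51]
  refine setIntegral_congr_fun measurableSet_Ioi fun t _ ↦ ?_
  simp only [laguerreFn]
  rw [exp_neg_eq_mul_half]
  ring

/-- The change of variables `x = eᵗ` of the proof of Cor 5.1: `(Π(x) − li(x))/x ∈ L²(1,∞)` iff
`{Π(eᵗ) − li(eᵗ)} e^{−t/2} ∈ L²(0,∞)`. [cite: AriasDeReyna2011KeiperLi, proof of Corollary 5.1 p.17] -/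
theorem integrableOn_sq_div_iff :
    IntegrableOn (fun x ↦ ((primePowerPi x - logIntegral x) / x) ^ 2) (Ioi 1) ↔
      IntegrableOn (fun t ↦ ((primePowerPi (Real.exp t) - logIntegral (Real.exp t)) *
        Real.exp (-t / 2)) ^ 2) (Ioi 0) := by
  rw [LogIntegralLaplace.integrableOn_Ioi_one_iff_integrableOn_exp]
  refine integrableOn_congr_fun (fun t _ ↦ ?_) measurableSet_Ioi
  have h0 : Real.exp t ≠ 0 := (Real.exp_pos t).ne'
  have h1 : Real.exp (-t / 2) ^ 2 = (Real.exp t)⁻¹ := by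
    rw [sq, ← exp_neg_eq_mul_half, Real.exp_neg]
  rw [mul_pow, h1, div_pow]
  field_simp

/-- RH-FREE, PROVED — **[AriasDeReyna2011KeiperLi] Corollary 5.1 p.17, the half `⟸`**: if
`(Π(x) − li(x))/x ∈ L²(1,∞)` (typed: `((Π x − li x)/x)²` integrable on `(1,∞)`), then the Riemann Hypothesis
holds.  The printed argument, with only BESSEL's inequality needed in this direction: by the change of
variables `g(t) = {Π(eᵗ) − li(eᵗ)}e^{−t/2} ∈ L²(0,∞)`, by (20) `A_n = ⟨g, ℓ_n⟩` for the orthonormal Laguerre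
functions `ℓ_n`, so `Σ A_n² ≤ ‖g‖² < ∞` and Thm 4.3 (⟸, `AriasDeReyna2011_thm43_mpr`) gives RH.  An RH-FREE
implication whose hypothesis is of RH strength; WHAT THIS IS NOT: nothing here asserts the hypothesis or
bears on the truth of RH. [cite: AriasDeReyna2011KeiperLi, Corollary 5.1 p.17] -/
theorem _root_.Literature.NumberTheory.LFunctions.AriasDeReyna2011_cor51_mpr
    (h : IntegrableOn (fun x ↦ ((primePowerPi x - logIntegral x) / x) ^ 2) (Ioi 1)) :
    RiemannHypothesis := by
  set g : ℝ → ℝ := fun t ↦ (primePowerPi (Real.exp t) - logIntegral (Real.exp t)) * Real.exp (-t / 2)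
    with hg
  have hg2 : IntegrableOn (fun t ↦ g t ^ 2) (Ioi 0) := integrableOn_sq_div_iff.mp h
  have hgm : AEStronglyMeasurable g (volume.restrict (Ioi 0)) := by
    refine (Measurable.aestronglyMeasurable ?_).restrict
    exact ((measurable_primePowerPi.comp Real.measurable_exp).sub
      (measurable_logIntegral.comp Real.measurable_exp)).mul (by fun_prop)
  have hsum := Literature.Analysis.SpecialFunctions.LaguerreOrthogonality.summable_sq_integral_mul_laguerreFn
    hgm hg2
  refine AriasDeReyna2011_thm43_mpr (hsum.congr fun n ↦ ?_)
  rw [ariasA_eq_integral_mul_laguerreFn n]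

/-- RH-CONSEQUENCE NAMED FACT — **[AriasDeReyna2011KeiperLi] Corollary 5.1 p.17, the half `⟹`**: the Riemann
Hypothesis implies `(Π(x) − li(x))/x ∈ L²(1,∞)`.  LINE 1: RH-CONSEQUENCE (binder explicit); nobody's target.
Printed proof: RH ⟹ `(A_n) ∈ ℓ²` (Cor 3.1 with Thm 4.2/4.3 — in the tree: `AriasDeReyna2011_thm43_holds`,
`AriasDeReynaKeiperLiCoefficientsProofs.lean`) «and according to (20) this is equivalent to
`{Π(eᵗ) − Li(eᵗ)}e^{−t/2} ∈ L²(0,∞)`» — i.e. PARSEVAL for the complete Laguerre system plus the tacit step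
that a function whose Laguerre coefficients (20) are square-summable, and which is not known to lie in `L²` a
priori, equals its `L²` Laguerre series (a uniqueness theorem for Laguerre expansions in a class containing
`g`; available e.g. from injectivity of the Laplace transform since under RH `g e^{−δt} ∈ L¹` for `δ < ½` by
von Koch).  Neither Parseval/completeness for `(ℓ_n)` nor that uniqueness step is in the tree, so this half
is vendored as a named fact (cell rh-crit GAP G-dbl-34).  NB: von Koch's `π(x) − li(x) = O(√x log x)` alone
does NOT give it (`(√x log x/x)² = (log x)²/x ∉ L¹(1,∞)`); the convergence of `∫(Π−li)²dx/x²` is a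
mean-square statement (cf. Cramér).  WHAT THIS IS NOT: a printed consequence of RH; nothing here bears on
the truth of RH. [cite: AriasDeReyna2011KeiperLi, Corollary 5.1 p.17] -/
def _root_.Literature.NumberTheory.LFunctions.AriasDeReyna2011_cor51_mp : Prop :=
  RiemannHypothesis → IntegrableOn (fun x ↦ ((primePowerPi x - logIntegral x) / x) ^ 2) (Ioi 1)

/-- PROVED MODULO THE NAMED FACT `AriasDeReyna2011_cor51_mp` — **[AriasDeReyna2011KeiperLi] Corollary 5.1
p.17** as printed: «The Riemann Hypothesis is equivalent to the function `(Π(x) − Li(x))/x` being in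
`L²(1,+∞)`.»  LINE 1: RH-EQUIVALENT·PRINTED record, proved as an equivalence modulo the ⟹ fact; the ⟸ half
is the RH-FREE theorem `AriasDeReyna2011_cor51_mpr`.  WHAT THIS IS NOT: neither side is asserted; nothing
here bears on the truth of RH. [cite: AriasDeReyna2011KeiperLi, Corollary 5.1 p.17] -/
theorem _root_.Literature.NumberTheory.LFunctions.AriasDeReyna2011_cor51_of_mp (h : AriasDeReyna2011_cor51_mp) :
    RiemannHypothesis ↔
      IntegrableOn (fun x ↦ ((primePowerPi x - logIntegral x) / x) ^ 2) (Ioi 1) :=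
  ⟨h, AriasDeReyna2011_cor51_mpr⟩

/-! ## Corollary 5.1 ⟹: discharge of `AriasDeReyna2011_cor51_mp`

Under RH, `(A_n) ∈ ℓ²` (Cor 3.1 + Thm 4.2, tree `AriasDeReyna2011_thm43_holds`), so `g̃ := Σ A_n ℓ_n`
converges in `L²(0,∞)` (Riesz–Fischer) and has the same Laguerre coefficients as
`g(t) = {Π(eᵗ) − li(eᵗ)} e^{−t/2}`; the difference `u = g − g̃` is exponentially tempered
(`∫ |u| e^{−t/2} e^{t/4} < ∞`, using von Koch's `Π − li = O(√x log x)` for `g`), so the uniqueness theorem for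
Laguerre expansions (`LaguerreExpansionUniqueness`, Szegő Thm 5.7.1) gives `u = 0` a.e., i.e. `g ∈ L²`. -/

namespace Cor51

open Literature.Analysis.SpecialFunctions.LaguerreOrthogonality
  (continuous_laguerreFn integrableOn_laguerreFn_mul_laguerreFn integral_laguerreFn_mul_laguerreFn
    integrableOn_mul_laguerreFn)

/-- `ℓ_n ∈ L²(0,∞)`. [cite: Szego1975, (5.1.1)] -/
theorem memLp_laguerreFn (n : ℕ) : MemLp (laguerreFn n) 2 (volume.restrict (Ioi (0 : ℝ))) := by
  rw [memLp_two_iff_integrable_sq (continuous_laguerreFn n).aestronglyMeasurable]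
  exact (integrableOn_laguerreFn_mul_laguerreFn n n).congr (Eventually.of_forall fun t ↦ by
    simp only; ring)

/-- The Laguerre functions as elements of `L²(0,∞)`. [cite: Szego1975, (5.1.1)] -/
theorem orthonormal_laguerreFn_toLp :
    Orthonormal ℝ (fun n : ℕ ↦ (memLp_laguerreFn n).toLp (laguerreFn n)) := by
  classical
  rw [orthonormal_iff_ite]
  intro i j
  rw [MeasureTheory.L2.inner_def]
  have e : (fun a : ℝ ↦ inner ℝ (((memLp_laguerreFn i).toLp (laguerreFn i)) a)
      (((memLp_laguerreFn j).toLp (laguerreFn j)) a)) =ᵐ[volume.restrict (Ioi (0 : ℝ))]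
      fun a ↦ laguerreFn j a * laguerreFn i a := by
    filter_upwards [(memLp_laguerreFn i).coeFn_toLp, (memLp_laguerreFn j).coeFn_toLp] with a ha hb
    rw [ha, hb]
    simp [mul_comm]
  rw [integral_congr_ae e]
  change ∫ a in Ioi (0 : ℝ), laguerreFn j a * laguerreFn i a = _
  rw [integral_laguerreFn_mul_laguerreFn j i]
  by_cases h : i = j
  · subst h; simp
  · rw [if_neg (Ne.symm h), if_neg h]

/-- Under RH: `{Π(x) − li(x)} x^{−7/4} ∈ L¹(1,∞)` (von Koch: `Π − li = O(√x log x)`; near `1` the singularity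
of `li` is integrable). [cite: AriasDeReyna2011KeiperLi, proof of Corollary 5.1 p.17] -/
theorem integrableOn_sub_mul_rpow_of_rh (hRH : RiemannHypothesis) :
    IntegrableOn (fun x ↦ (primePowerPi x - logIntegral x) * x ^ (-(7 / 4 : ℝ))) (Ioi 1) := by
  obtain ⟨C, hC0, hC⟩ := (primeCounting_sub_logIntegral_isBigO_of_riemannHypothesis hRH).exists_nonneg
  obtain ⟨X, hX⟩ := eventually_atTop.mp (hC.bound.and (eventually_ge_atTop (2 : ℝ)))
  set X' : ℝ := max X 2 with hX'
  have hX'1 : 1 < X' := lt_of_lt_of_le one_lt_two (le_max_right _ _)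
  have hsplit : Ioi (1 : ℝ) = Ioc 1 X' ∪ Ioi X' := (Ioc_union_Ioi_eq_Ioi hX'1.le).symm
  have hmeasf : Measurable fun x ↦ primePowerPi x - logIntegral x :=
    measurable_primePowerPi.sub measurable_logIntegral
  -- on `(1, X']`
  have h1 : IntegrableOn (fun x ↦ (primePowerPi x - logIntegral x) * x ^ (-(7 / 4 : ℝ))) (Ioc 1 X') := by
    have hPi : IntegrableOn primePowerPi (Ioc 1 X') := by
      refine Integrable.mono' (integrableOn_const (C := X') (measure_Ioc_lt_top).ne)
        measurable_primePowerPi.aestronglyMeasurable ?_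
      rw [ae_restrict_iff' measurableSet_Ioc]
      refine Eventually.of_forall fun x hx ↦ ?_
      have h0 : 0 ≤ x := by linarith [hx.1]
      rw [Real.norm_eq_abs, abs_of_nonneg (primePowerPi_nonneg_le h0).1]
      exact (primePowerPi_nonneg_le h0).2.trans hx.2
    have hdiff : IntegrableOn (fun x ↦ primePowerPi x - logIntegral x) (Icc 1 X') := by
      rw [integrableOn_Icc_iff_integrableOn_Ioc]
      exact hPi.sub (LogIntegralLaplace.integrableOn_logIntegral_Ioc X')
    have hcont : ContinuousOn (fun x : ℝ ↦ x ^ (-(7 / 4 : ℝ))) (Icc 1 X') :=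
      ContinuousOn.rpow_const continuousOn_id fun t ht ↦ Or.inl (by
        show id t ≠ 0; simp only [id]; linarith [ht.1])
    exact (hdiff.mul_continuousOn hcont isCompact_Icc).mono_set Ioc_subset_Icc_self
  -- on `(X', ∞)`: `|Π − li| ≤ (2/log 2 + C) √x log x`, times `x^{−7/4}` is `≤ C' log x · x^{−5/4}`
  have hb : IntegrableOn (fun x : ℝ ↦ Real.log x * x ^ (-(5 / 4 : ℝ))) (Ioi 1) := by
    rw [LogIntegralLaplace.integrableOn_Ioi_one_iff_integrableOn_exp]
    have h := integrableOn_rpow_mul_exp_neg_mul_rpow (s := 1) (p := 1) (b := 1 / 4)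
      (by norm_num) le_rfl (by norm_num)
    refine h.congr_fun (fun t (ht : 0 < t) ↦ ?_) measurableSet_Ioi
    dsimp only
    rw [Real.log_exp, Real.rpow_one, ← Real.exp_mul]
    have : Real.exp t * Real.exp (t * -(5 / 4 : ℝ)) = Real.exp (-(1 / 4) * t) := by
      rw [← Real.exp_add]; ring_nf
    calc t * Real.exp (-(1 / 4) * t) = t * (Real.exp t * Real.exp (t * -(5 / 4 : ℝ))) := by rw [this]
      _ = Real.exp t * (t * Real.exp (t * -(5 / 4 : ℝ))) := by ring
  have h2 : IntegrableOn (fun x ↦ (primePowerPi x - logIntegral x) * x ^ (-(7 / 4 : ℝ))) (Ioi X') := by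
    have hb' := (hb.mono_set (Ioi_subset_Ioi hX'1.le)).const_mul (2 / Real.log 2 + C)
    refine Integrable.mono' hb' ((hmeasf.mul (measurable_id.pow_const _)).aestronglyMeasurable) ?_
    rw [ae_restrict_iff' measurableSet_Ioi]
    refine Eventually.of_forall fun x (hx : X' < x) ↦ ?_
    have hx1 : 1 < x := hX'1.trans hx
    have hx0 : 0 < x := by linarith
    obtain ⟨hvk, hx2⟩ := hX x ((le_max_left _ _).trans hx.le)
    have hl : 0 < Real.log x := Real.log_pos hx1
    have hl2 : 0 < Real.log 2 := Real.log_pos one_lt_two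
    rw [Real.norm_eq_abs, Real.norm_of_nonneg (by positivity)] at hvk
    obtain ⟨hp0, hp1⟩ := primePowerPi_sub_primeCounting_bounds hx1.le
    have habs : |primePowerPi x - logIntegral x| ≤ (2 / Real.log 2 + C) * (Real.sqrt x * Real.log x) := by
      have e : primePowerPi x - logIntegral x = (primePowerPi x - (Nat.primeCounting ⌊x⌋₊ : ℝ)) +
          ((Nat.primeCounting ⌊x⌋₊ : ℝ) - logIntegral x) := by ring
      rw [e]
      refine (abs_add_le _ _).trans ?_
      rw [abs_of_nonneg hp0, add_mul]
      refine add_le_add ?_ hvk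
      calc primePowerPi x - (Nat.primeCounting ⌊x⌋₊ : ℝ) ≤ 2 * Real.sqrt x * Real.log x / Real.log 2 := hp1
        _ = 2 / Real.log 2 * (Real.sqrt x * Real.log x) := by field_simp
    rw [Real.norm_eq_abs, abs_mul, abs_of_pos (Real.rpow_pos_of_pos hx0 _)]
    have hsq : Real.sqrt x * x ^ (-(7 / 4 : ℝ)) = x ^ (-(5 / 4 : ℝ)) := by
      rw [Real.sqrt_eq_rpow, ← Real.rpow_add hx0]; norm_num
    calc |primePowerPi x - logIntegral x| * x ^ (-(7 / 4 : ℝ))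
        ≤ (2 / Real.log 2 + C) * (Real.sqrt x * Real.log x) * x ^ (-(7 / 4 : ℝ)) := by gcongr
      _ = (2 / Real.log 2 + C) * (Real.log x * (Real.sqrt x * x ^ (-(7 / 4 : ℝ)))) := by ring
      _ = (2 / Real.log 2 + C) * (Real.log x * x ^ (-(5 / 4 : ℝ))) := by rw [hsq]
  rw [hsplit]
  exact h1.union h2

/-- Under RH, `g(t) e^{−t/4} = {Π(eᵗ) − li(eᵗ)} e^{−3t/4} ∈ L¹(0,∞)`. [cite: AriasDeReyna2011KeiperLi, proof of Corollary 5.1 p.17] -/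
theorem integrableOn_g_mul_exp_of_rh (hRH : RiemannHypothesis) :
    IntegrableOn (fun t ↦ (primePowerPi (Real.exp t) - logIntegral (Real.exp t)) *
      Real.exp (-(3 / 4 : ℝ) * t)) (Ioi 0) := by
  have h := integrableOn_sub_mul_rpow_of_rh hRH
  rw [LogIntegralLaplace.integrableOn_Ioi_one_iff_integrableOn_exp] at h
  refine h.congr_fun (fun t _ ↦ ?_) measurableSet_Ioi
  dsimp only
  rw [← Real.exp_mul]
  have : Real.exp t * Real.exp (t * -(7 / 4 : ℝ)) = Real.exp (-(3 / 4 : ℝ) * t) := by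
    rw [← Real.exp_add]; ring_nf
  calc Real.exp t * ((primePowerPi (Real.exp t) - logIntegral (Real.exp t)) * Real.exp (t * -(7 / 4 : ℝ)))
      = (primePowerPi (Real.exp t) - logIntegral (Real.exp t)) * (Real.exp t * Real.exp (t * -(7 / 4 : ℝ))) := by
        ring
    _ = _ := by rw [this]

/-- `g ℓ_n ∈ L¹(0,∞)` with `g(t) = {Π(eᵗ) − li(eᵗ)} e^{−t/2}` (the integrand of Thm 5.1 (20)).
[cite: AriasDeReyna2011KeiperLi, Theorem 5.1 eq. (20) p.17] -/
theorem integrableOn_g_mul_laguerreFn (n : ℕ) :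
    IntegrableOn (fun t ↦ (primePowerPi (Real.exp t) - logIntegral (Real.exp t)) * Real.exp (-t / 2) *
      laguerreFn n t) (Ioi 0) := by
  -- `(Π−li)(eᵗ) tʲ e^{−t}` is integrable for every `j` (hypothesis of Prop 5.1, moved to `(0,∞)`)
  have hj : ∀ j : ℕ, IntegrableOn (fun t ↦ (primePowerPi (Real.exp t) - logIntegral (Real.exp t)) *
      t ^ j * Real.exp (-t)) (Ioi 0) := by
    intro j
    have h := integrableOn_primePowerPi_sub_logIntegral j
    rw [LogIntegralLaplace.integrableOn_Ioi_one_iff_integrableOn_exp] at h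
    refine h.congr_fun (fun t _ ↦ ?_) measurableSet_Ioi
    dsimp only
    rw [Real.log_exp, ← Real.exp_mul]
    have : Real.exp t * Real.exp (t * (-2 : ℝ)) = Real.exp (-t) := by
      rw [← Real.exp_add]; ring_nf
    calc Real.exp t * ((primePowerPi (Real.exp t) - logIntegral (Real.exp t)) * t ^ j * Real.exp (t * (-2 : ℝ)))
        = (primePowerPi (Real.exp t) - logIntegral (Real.exp t)) * t ^ j *
            (Real.exp t * Real.exp (t * (-2 : ℝ))) := by ring
      _ = _ := by rw [this]
  have e : (fun t ↦ (primePowerPi (Real.exp t) - logIntegral (Real.exp t)) * Real.exp (-t / 2) *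
      laguerreFn n t) = fun t ↦ ∑ j ∈ range (n + 1), (-1) ^ j * (n.choose j : ℝ) / (j ! : ℝ) *
        ((primePowerPi (Real.exp t) - logIntegral (Real.exp t)) * t ^ j * Real.exp (-t)) := by
    funext t
    simp only [laguerreFn]
    rw [eval_laguerre_zero_eq, exp_neg_eq_mul_half t]
    simp only [Finset.sum_mul, Finset.mul_sum]
    refine Finset.sum_congr rfl fun j _ ↦ ?_
    ring
  rw [e]
  exact integrable_finsetSum _ fun j _ ↦ (hj j).const_mul _

end Cor51

/-- RH-CONSEQUENCE, PROVED (binder explicit) — **[AriasDeReyna2011KeiperLi] Corollary 5.1 p.17, the half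
`⟹`**, discharging the named fact `AriasDeReyna2011_cor51_mp`: the Riemann Hypothesis implies
`(Π(x) − li(x))/x ∈ L²(1,∞)`.  Proof (the paper's «according to (20)» made honest): RH ⟹ `(A_n) ∈ ℓ²`
(`AriasDeReyna2011_thm43_holds`); `g̃ = Σ A_n ℓ_n` converges in `L²(0,∞)` (orthonormality + completeness of
`L²`) with `⟨g̃, ℓ_n⟩ = A_n = ∫ g ℓ_n`; `u = g − g̃` satisfies `∫ u ℓ_n = 0` for all `n` and
`∫ |u| e^{−t/2} e^{t/4} dt < ∞` (von Koch for `g`, Cauchy–Schwarz for `g̃`), so `u = 0` a.e. by the uniqueness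
theorem for Laguerre expansions (`LaguerreExpansionUniqueness.ae_eq_zero_of_forall_integral_mul_laguerre_eq_zero`,
Szegő Thm 5.7.1); hence `g ∈ L²(0,∞)`, i.e. `(Π − li)/x ∈ L²(1,∞)`.  WHAT THIS IS NOT: a printed consequence
of RH formalised as such; nothing here bears on the truth of RH. [cite: AriasDeReyna2011KeiperLi, Corollary 5.1 p.17] -/
theorem _root_.Literature.NumberTheory.LFunctions.AriasDeReyna2011_cor51_mp_holds : AriasDeReyna2011_cor51_mp := by
  classical
  intro hRH
  -- notation
  set μ : Measure ℝ := volume.restrict (Ioi (0 : ℝ)) with hμ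
  set g : ℝ → ℝ := fun t ↦ (primePowerPi (Real.exp t) - logIntegral (Real.exp t)) * Real.exp (-t / 2)
    with hg
  have hgm : Measurable g :=
    ((measurable_primePowerPi.comp Real.measurable_exp).sub
      (measurable_logIntegral.comp Real.measurable_exp)).mul (by fun_prop)
  -- (1) `(A_n) ∈ ℓ²` under RH
  have hA2 : Summable (fun n ↦ ariasA n ^ 2) := AriasDeReyna2011_thm43_holds.mp hRH
  -- (2) Riesz–Fischer: `g̃ = Σ A_n ℓ_n` in `L²(0,∞)`
  set e : ℕ → Lp ℝ 2 μ := fun n ↦ (Cor51.memLp_laguerreFn n).toLp (laguerreFn n) with he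
  have hON : Orthonormal ℝ e := Cor51.orthonormal_laguerreFn_toLp
  have hsum : Summable (fun n ↦ ariasA n • e n) := by
    have hV := hON.orthogonalFamily
    have h := (hV.summable_iff_norm_sq_summable (fun n ↦ ariasA n)).mpr (by
      simpa only [Real.norm_eq_abs, sq_abs] using hA2)
    simpa only [LinearIsometry.toSpanSingleton_apply] using h
  set G : Lp ℝ 2 μ := ∑' n, ariasA n • e n with hG
  have hGsum : HasSum (fun n ↦ ariasA n • e n) G := hsum.hasSum
  -- `⟨e m, G⟩ = A_m`
  have hinner : ∀ m, inner ℝ (e m) G = ariasA m := by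
    intro m
    have h1 : HasSum (fun n ↦ inner ℝ (e m) (ariasA n • e n)) (inner ℝ (e m) G) := by
      have := (innerSL ℝ (e m)).hasSum hGsum
      simpa only [innerSL_apply_apply] using this
    have h2 : HasSum (fun n ↦ inner ℝ (e m) (ariasA n • e n)) (ariasA m) := by
      have hfun : (fun n ↦ inner ℝ (e m) (ariasA n • e n)) = fun n ↦ if n = m then ariasA m else 0 := by
        funext n
        rw [real_inner_smul_right, orthonormal_iff_ite.mp hON m n]
        by_cases h : n = m
        · subst h; simp
        · rw [if_neg (Ne.symm h), if_neg h, mul_zero]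
      rw [hfun]
      exact hasSum_ite_eq m (ariasA m)
    exact h1.unique h2
  -- (3) a measurable representative `G'` of `G`, square integrable, with `∫ G' ℓ_m = A_m`
  have hGae : AEStronglyMeasurable (G : ℝ → ℝ) μ := Lp.aestronglyMeasurable G
  set G' : ℝ → ℝ := hGae.mk (G : ℝ → ℝ) with hG'
  have hG'm : Measurable G' := hGae.stronglyMeasurable_mk.measurable
  have hGG' : (G : ℝ → ℝ) =ᵐ[μ] G' := hGae.ae_eq_mk
  have hG'2 : IntegrableOn (fun t ↦ G' t ^ 2) (Ioi 0) := by
    have h := (Lp.memLp G).integrable_sq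
    refine h.congr ?_
    filter_upwards [hGG'] with t ht
    rw [ht]
  have hG'ae : AEStronglyMeasurable G' μ := hG'm.aestronglyMeasurable
  have hintG' : ∀ m, ∫ t in Ioi (0 : ℝ), G' t * laguerreFn m t = ariasA m := by
    intro m
    rw [← hinner m, MeasureTheory.L2.inner_def]
    refine integral_congr_ae ?_
    filter_upwards [hGG', (Cor51.memLp_laguerreFn m).coeFn_toLp] with t ht hlt
    rw [show (e m : ℝ → ℝ) t = laguerreFn m t from hlt, ← ht]
    simp [mul_comm]
  -- (4) the difference `u = g − G'` and `w = u e^{−t/2}`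
  set w : ℝ → ℝ := fun t ↦ (g t - G' t) * Real.exp (-t / 2) with hw
  have hwm : Measurable w := (hgm.sub hG'm).mul (by fun_prop)
  -- temperedness: `w e^{t/4} = g e^{−t/4} − G' e^{−t/4} ∈ L¹(0,∞)`
  have hexp14 : IntegrableOn (fun t : ℝ ↦ Real.exp (-((1 / 2 : ℝ)) * t)) (Ioi 0) :=
    exp_neg_integrableOn_Ioi 0 (by norm_num)
  have hgpart : IntegrableOn (fun t ↦ g t * Real.exp (-t / 2) * Real.exp ((1 / 4 : ℝ) * t)) (Ioi 0) := by
    refine (Cor51.integrableOn_g_mul_exp_of_rh hRH).congr_fun (fun t _ ↦ ?_) measurableSet_Ioi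
    simp only [hg]
    have : Real.exp (-(3 / 4 : ℝ) * t) = Real.exp (-t / 2) * Real.exp (-t / 2) * Real.exp ((1 / 4 : ℝ) * t) := by
      rw [← Real.exp_add, ← Real.exp_add]; ring_nf
    rw [this]; ring
  have hG'part : IntegrableOn (fun t ↦ G' t * Real.exp (-t / 2) * Real.exp ((1 / 4 : ℝ) * t)) (Ioi 0) := by
    -- `2|G' e^{−t/4}| ≤ G'² + e^{−t/2}`
    have hb : IntegrableOn (fun t ↦ (G' t ^ 2 + Real.exp (-((1 / 2 : ℝ)) * t)) / 2) (Ioi 0) :=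
      (hG'2.add hexp14).div_const 2
    refine Integrable.mono' hb ((hG'ae.mul (by fun_prop)).mul (by fun_prop)) ?_
    refine Eventually.of_forall fun t ↦ ?_
    have e1 : Real.exp (-t / 2) * Real.exp ((1 / 4 : ℝ) * t) = Real.exp (-((1 / 4 : ℝ)) * t) := by
      rw [← Real.exp_add]; ring_nf
    have e2 : Real.exp (-((1 / 2 : ℝ)) * t) = Real.exp (-((1 / 4 : ℝ)) * t) ^ 2 := by
      rw [sq, ← Real.exp_add]; ring_nf
    rw [mul_assoc, e1, Real.norm_eq_abs, abs_mul, Real.abs_exp, e2]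
    have := two_mul_le_add_sq |G' t| (Real.exp (-((1 / 4 : ℝ)) * t))
    rw [sq_abs] at this
    linarith
  have hwexp : IntegrableOn (fun t ↦ w t * Real.exp ((1 / 4 : ℝ) * t)) (Ioi 0) := by
    refine (hgpart.sub hG'part).congr_fun (fun t _ ↦ ?_) measurableSet_Ioi
    simp only [hw, Pi.sub_apply]; ring
  -- vanishing Laguerre integrals: `∫ w L_n = ∫ g ℓ_n − ∫ G' ℓ_n = A_n − A_n`
  have hgl : ∀ n, IntegrableOn (fun t ↦ g t * laguerreFn n t) (Ioi 0) :=
    fun n ↦ Cor51.integrableOn_g_mul_laguerreFn n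
  have hG'l : ∀ n, IntegrableOn (fun t ↦ G' t * laguerreFn n t) (Ioi 0) :=
    fun n ↦ Literature.Analysis.SpecialFunctions.LaguerreOrthogonality.integrableOn_mul_laguerreFn hG'ae hG'2 n
  have hlag : ∀ n : ℕ, ∫ t in Ioi (0 : ℝ), w t * (laguerre 0 n).eval t = 0 := by
    intro n
    have e : (fun t ↦ w t * (laguerre 0 n).eval t) = fun t ↦ g t * laguerreFn n t - G' t * laguerreFn n t := by
      funext t; simp only [hw, laguerreFn]; ring
    rw [e, integral_sub (hgl n) (hG'l n), hintG' n]
    have : ∫ t in Ioi (0 : ℝ), g t * laguerreFn n t = ariasA n := by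
      rw [ariasA_eq_integral_mul_laguerreFn n]
    rw [this, sub_self]
  -- (5) uniqueness of Laguerre expansions: `w = 0` a.e., so `g = G'` a.e. on `(0,∞)`
  have hw0 := Literature.Analysis.SpecialFunctions.LaguerreExpansionUniqueness.ae_eq_zero_of_forall_integral_mul_laguerre_eq_zero
    hwm (by norm_num : (0 : ℝ) < 1 / 4) hwexp hlag
  have hgG' : ∀ᵐ t ∂μ, g t = G' t := by
    rw [hμ, ae_restrict_iff' measurableSet_Ioi]
    filter_upwards [hw0] with t ht ht0
    have h := ht ht0
    simp only [hw, mul_eq_zero, Real.exp_ne_zero, or_false] at h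
    linarith
  -- (6) hence `g ∈ L²(0,∞)`, i.e. `(Π − li)/x ∈ L²(1,∞)`
  have hg2 : IntegrableOn (fun t ↦ g t ^ 2) (Ioi 0) := by
    refine hG'2.congr ?_
    filter_upwards [hgG'] with t ht
    rw [ht]
  exact integrableOn_sq_div_iff.mpr hg2

/-- RH-EQUIVALENT·PRINTED, PROVED AS AN EQUIVALENCE — **[AriasDeReyna2011KeiperLi] Corollary 5.1 p.17**:
«The Riemann Hypothesis is equivalent to the function `(Π(x) − Li(x))/x` being in `L²(1,+∞)`.»
(`Π = primePowerPi`, `Li = li = logIntegral`, `∈ L²` typed as square-integrability.)  Neither side is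
asserted; WHAT THIS IS NOT: nothing here bears on the truth of RH. [cite: AriasDeReyna2011KeiperLi, Corollary 5.1 p.17] -/
theorem _root_.Literature.NumberTheory.LFunctions.AriasDeReyna2011_cor51 :
    RiemannHypothesis ↔
      IntegrableOn (fun x ↦ ((primePowerPi x - logIntegral x) / x) ^ 2) (Ioi 1) :=
  AriasDeReyna2011_cor51_of_mp AriasDeReyna2011_cor51_mp_holds

end AriasDeReyna2011Primes

end Literature.NumberTheory.LFunctions
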